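import Literature.NumberTheory.Transcendental.ManyCurveLineODE
import Literature.NumberTheory.Transcendental.AuxiliaryFunctionSharp
import Literature.NumberTheory.Transcendental.LiouvilleStep
import HarnessLib

/-!
# Baker data on the `k`-lattice standard models: number field, `K`-models, Siegel step, line values, Liouville

Topic `Literature/NumberTheory/Transcendental`; unit
`provefact-Literature.NumberTheory.Transcendental.H-0a3eb64689` (fact
`Literature.NumberTheory.Transcendental.HuberWustholzManyCurvePeriods`, `ManyCurvePeriods.lean`).
It introduces NO named fact. Lattice-family counterpart of the two-lattice `TwoCurveBaker.lean`
(port of the one-lattice files `GeneratorValues.lean`, `AlgMultiples.lean`, `BakerField.lean`,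
`BakerModels.lean`, `SiegelEntries.lean`, `SiegelSystem.lean`, `AuxiliaryFunction.lean`,
`LineValues.lean`, `LiouvilleStep.lean`, `AuxiliaryFunctionSharp.lean`), for the family standard
models `M = 𝔾ₘ^β × P` (`ManyCurveStd.lean`, …, `ManyCurveLineODE.lean`; lattice family
`L : 𝓙 → PeriodPair` on a FINITE class type `𝓙`, class map `cls : γ → 𝓙`).

## What is proved here (everything; no `sorry`, no new `def … : Prop`)

* `TorsionCoords` (lattice coordinates of `N z'_b(v)` in the lattice OF THE BLOCK), the generator
  values at the multiples `s·v` (`genFun_torus_mul`, `genFun_factor_mul`, `genFun_fibre_mul`: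
  `Ñ_e(s·v) = q·Ñ_e(N·v) + Ñ_e(r·v)`), `torsionCoords_of_mem_algTors`; `nsmul_mem_Alg(Tors)`,
  `isAlgebraic_genFun_zero_nsmul`;
* `BakerData` (lattice family `Λ_i`, class map, algebraic invariants `g₂(Λ_i), g₃(Λ_i)`, a point
  of `Alg` with torsion abelian part, directions), its finite family of algebraic numbers (`BIdx`,
  the `2·#𝓙` invariants), the number field `K`, the generator values `gK s` over `K` with
  denominators and conjugates (`isIntegral_den_pow_mul_gK`, `norm_embedding_gK_le`);
* the `K`-models `QK`, `HK` (classwise invariants `g2K i, g3K i`), `map_QK`, `map_HK`, degrees and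
  denominators (`isDenInt_QK`, `isDenInt_HK`);
* the Siegel system (`sMat`, `house_sMat_le`, `rowSum_eq_zero_of_mulVec`), the auxiliary function
  (`QOf`, `vanishesAlong_of_mulVec`, `exists_auxiliary`, sharp count `exists_auxiliary₂`);
* line values (`iteratedDeriv_thetaEval_line_sum_eq`, `lineValPoly`, `iteratedDeriv_grid_eq`) and the
  Liouville step (`intZ_lineVal`, `norm_embedding_lineVal_le`, `lineVal_eq_zero_of_norm_lt`).
Generic one-lattice material (`UIdx`, `νOf`, `ArithPoly.*`, degree bounds of the per-factor models)
is reused, not re-proved.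

## References

* A. Baker, G. Wüstholz, *Logarithmic Forms and Diophantine Geometry*, CUP 2007, §6.8 (pp. 116–119).
  [BakerWustholz2007]
* A. Baker, *Transcendental Number Theory*, CUP 1975, Ch. 2 §3 (Siegel, Liouville). [BakerTNT1975]
* A. Huber, G. Wüstholz, *Transcendence and Linear Relations of 1-Periods*, Cambridge Tracts 227,
  CUP 2022, Thm. 15.3 (1). [HuberWustholz2022]
-/

noncomputable section

open Complex Filter Topology MvPolynomial
open scoped PeriodPair

namespace Literature.NumberTheory.Transcendental

namespace GaGmEFam

namespace Std

open GaGmE (Kbar)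
open GaGmE.Std (iy iz is coords coords_iy coords_iz coords_is sum_blocks ThetaIdx thetaT thetaT_none
  thetaT_some differentiable_thetaT VanishesAlong isAlgebraic_coe_Kbar
  Gen factorGen zetaHat zetaHatDer factorODE zetaHatODE FactorChartValid isOpen_factorChartValid
  factorGen_false factorGen_true zetaHat_false zetaHat_true hasDerivAt_zetaHat
  baseFin baseIdx rPoly corrPoly TPoly rVal corrVal factor_blocks line_apply genFin genIdx
  rVal_baseFin corrVal_baseFin rVal_genFin genericChart affGen affIdx homog isHomogeneous_homog
  eval_homog_of_base_eq_one factorODEᵣ zetaHatODEᵣ rPolyᵣ corrPolyᵣ TPolyᵣ homogMonomialᵣ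
  map_homogMonomialᵣ homog_monomial homog_add homog_zero homog_sum homog_eq_sum)
open GaGmE.Std.BakerData (UIdx νOf νOf_apply νOf_injective degree_νOf_le degree_mapDomain_affIdx
  degree_eq_sum_support card_UIdx)

variable {𝓙 : Type} [Fintype 𝓙] [DecidableEq 𝓙] {β γ δ : Type} [Fintype β] [Fintype γ] [Fintype δ]
variable [DecidableEq γ]
variable (L : 𝓙 → PeriodPair) (cls : γ → 𝓙) (κM : δ → γ → Kbar)

/-! ### Points with torsion abelian coordinates and the generator values at their multiples -/

section TorsionMultiples

/-- Lattice coordinates of `N·z'_b(v)`: the `E`-coordinates of `v` are `N`-torsion for a COMMON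
`N`, with chosen integer coordinates `(m_b, n_b)` of `N z'_b(v) ∈ Λ`. The tree's torsion notions are
`PeriodPair.IsTorsionPt` and `Std.AlgTors` (`SemistableTorsion.lean`, per-coordinate orders
`N_b ≥ 1`); `torsionCoords_of_mem_algTors` below produces this structure from them with
`N = ∏_b N_b`. [folklore] -/
structure TorsionCoords (v : β ⊕ (γ ⊕ δ) → ℂ) (N : ℕ) where
  /-- first lattice coordinate of `N z'_b` -/
  m : γ → ℤ
  /-- second lattice coordinate of `N z'_b` -/
  n : γ → ℤ
  /-- `N z'_b = m_b ω₁ + n_b ω₂` -/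
  eq : ∀ b, (N : ℂ) * v (iz b) = m b * (L (cls b)).ω₁ + n b * (L (cls b)).ω₂


variable {L cls}
variable {v : β ⊕ (γ ⊕ δ) → ℂ} {N : ℕ}

omit [Fintype β] [Fintype γ] [Fintype δ] [DecidableEq γ] in
omit [Fintype 𝓙] [DecidableEq 𝓙] in
/-- `s·z'_b = r·z'_b + q·(N z'_b)` for `s = qN + r`. [folklore] -/
theorem TorsionCoords.mul_coord (tc : TorsionCoords L cls v N) (q r : ℕ) (b : γ) :
    ((q * N + r : ℕ) : ℂ) * v (iz b) =
      (r : ℂ) * v (iz b) + ((q * tc.m b : ℤ) * (L (cls b)).ω₁ + (q * tc.n b : ℤ) * (L (cls b)).ω₂) := by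
  have := tc.eq b
  push_cast
  linear_combination (q : ℂ) * this


omit [Fintype β] [Fintype γ] [Fintype δ] [DecidableEq γ] in
omit [Fintype 𝓙] [DecidableEq 𝓙] in
/-- Lattice membership of `s·z'_b` only depends on `s mod N`. [folklore] -/
theorem TorsionCoords.mem_lattice_iff (tc : TorsionCoords L cls v N) (q r : ℕ) (b : γ) :
    ((q * N + r : ℕ) : ℂ) * v (iz b) ∈ (L (cls b)).lattice ↔ (r : ℂ) * v (iz b) ∈ (L (cls b)).lattice := by
  rw [tc.mul_coord q r b]
  have hl := (L (cls b)).int_mul_add_int_mul_mem_lattice (q * tc.m b) (q * tc.n b)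
  constructor
  · intro h
    simpa using (L (cls b)).lattice.sub_mem h hl
  · intro h
    exact (L (cls b)).lattice.add_mem h hl


omit [Fintype β] [Fintype γ] [Fintype δ] [DecidableEq γ] in
omit [Fintype 𝓙] [DecidableEq 𝓙] in
/-- **The adapted chart choice at `s·v` is that at `r·v`**, `s = qN + r`. [folklore] -/
theorem chartChoiceAt_mul (tc : TorsionCoords L cls v N) (q r : ℕ) :
    chartChoiceAt L cls (((q * N + r : ℕ) : ℂ) • v) = chartChoiceAt L cls (β := β) (δ := δ) ((r : ℂ) • v) := by
  funext b
  simp only [chartChoiceAt, Pi.smul_apply, smul_eq_mul]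
  by_cases h : (r : ℂ) * v (iz b) ∈ (L (cls b)).lattice
  · rw [if_pos h, if_pos ((tc.mem_lattice_iff q r b).mpr h)]
  · rw [if_neg h, if_neg (mt (tc.mem_lattice_iff q r b).mp h)]


omit [Fintype β] [Fintype δ] [DecidableEq γ] in
omit [Fintype 𝓙] [DecidableEq 𝓙] in
/-- **Torus generators at multiples**: `E_j(s·v) = (e^{y_j(v)})^s`. [folklore] -/
theorem genFun_torus_mul (c : γ → Bool) (x : β ⊕ (γ ⊕ δ) → ℂ) (s : ℕ) (j : β) :
    genFun L cls κM c ((s : ℂ) • v) x 0 (Sum.inl j) = cexp (v (iy j)) ^ s := by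
  simp [genFun, ← Complex.exp_nat_mul]


omit [Fintype β] [Fintype δ] [DecidableEq γ] in
omit [Fintype 𝓙] [DecidableEq 𝓙] in
/-- **Factor generators at multiples**: with the adapted charts, the factor generators at `s·v`
equal those at `r·v`, `s = qN + r` (`℘, ℘′` are periodic; `u = p = 0` on the lattice). [folklore] -/
theorem genFun_factor_mul (tc : TorsionCoords L cls v N) (x : β ⊕ (γ ⊕ δ) → ℂ) (q r : ℕ) (b : γ) (i : Fin 2) :
    genFun L cls κM (chartChoiceAt L cls (((q * N + r : ℕ) : ℂ) • v)) (((q * N + r : ℕ) : ℂ) • v) x 0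
        (Sum.inr (Sum.inl (b, i))) =
      genFun L cls κM (chartChoiceAt L cls ((r : ℂ) • v)) ((r : ℂ) • v) x 0 (Sum.inr (Sum.inl (b, i))) := by
  rw [chartChoiceAt_mul tc]
  simp only [genFun, Pi.smul_apply, smul_eq_mul, zero_mul, add_zero]
  by_cases hr : (r : ℂ) * v (iz b) ∈ (L (cls b)).lattice
  · -- origin chart at both points: `u = p = 0`
    have hcb : chartChoiceAt L cls ((r : ℂ) • v) b = true := by
      simp [chartChoiceAt, Pi.smul_apply, smul_eq_mul, hr]
    have hs : ((q * N + r : ℕ) : ℂ) * v (iz b) ∈ (L (cls b)).lattice := (tc.mem_lattice_iff q r b).mpr hr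
    obtain ⟨m₁, n₁, h₁⟩ := PeriodPair.mem_lattice.mp hs
    obtain ⟨m₂, n₂, h₂⟩ := PeriodPair.mem_lattice.mp hr
    have v1 := (L (cls b)).latU_latP_latG_lattice m₁ n₁
    have v2 := (L (cls b)).latU_latP_latG_lattice m₂ n₂
    rw [h₁] at v1
    rw [h₂] at v2
    rw [hcb]
    fin_cases i
    · simp only [factorGen_true, Fin.zero_eta, Matrix.cons_val_zero]
      rw [v1.2.1, v2.2.1]
    · simp only [factorGen_true, Fin.mk_one, Matrix.cons_val_one, Matrix.cons_val_fin_one]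
      rw [v1.2.2.1, v2.2.2.1]
  · have hcb : chartChoiceAt L cls ((r : ℂ) • v) b = false := by
      simp [chartChoiceAt, Pi.smul_apply, smul_eq_mul, hr]
    rw [hcb, tc.mul_coord q r b]
    have hl := (L (cls b)).int_mul_add_int_mul_mem_lattice (q * tc.m b) (q * tc.n b)
    fin_cases i
    · simpa using (L (cls b)).weierstrassP_add_coe ((r : ℂ) * v (iz b)) ⟨_, hl⟩
    · simpa using (L (cls b)).derivWeierstrassP_add_coe ((r : ℂ) * v (iz b)) ⟨_, hl⟩


omit [Fintype β] [Fintype γ] [Fintype δ] [DecidableEq γ] in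
omit [Fintype 𝓙] [DecidableEq 𝓙] in
/-- The `ζ`-type function of the adapted chart at a multiple: `ζ̂(s z'_b) = ζ̂(r z'_b) + q η(N z'_b)`.
[folklore] -/
theorem zetaHat_mul (tc : TorsionCoords L cls v N) (q r : ℕ) (b : γ) :
    zetaHat (L (cls b)) (chartChoiceAt L cls (((q * N + r : ℕ) : ℂ) • v) b) (((q * N + r : ℕ) : ℂ) * v (iz b)) =
      zetaHat (L (cls b)) (chartChoiceAt L cls (β := β) (δ := δ) ((r : ℂ) • v) b) ((r : ℂ) * v (iz b)) +
        ((q * tc.m b : ℤ) * (L (cls b)).η₁ + (q * tc.n b : ℤ) * (L (cls b)).η₂) := by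
  rw [chartChoiceAt_mul tc]
  by_cases hr : (r : ℂ) * v (iz b) ∈ (L (cls b)).lattice
  · -- both lattice points: `g = η` is additive in the lattice coordinates
    have hcb : chartChoiceAt L cls ((r : ℂ) • v) b = true := by
      simp [chartChoiceAt, Pi.smul_apply, smul_eq_mul, hr]
    obtain ⟨m₂, n₂, h₂⟩ := PeriodPair.mem_lattice.mp hr
    rw [hcb, zetaHat_true, zetaHat_true]
    have e1 : ((q * N + r : ℕ) : ℂ) * v (iz b) =
        ((m₂ + q * tc.m b : ℤ) : ℂ) * (L (cls b)).ω₁ + ((n₂ + q * tc.n b : ℤ) : ℂ) * (L (cls b)).ω₂ := by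
      rw [tc.mul_coord q r b, ← h₂]; push_cast; ring
    rw [e1, ((L (cls b)).latU_latP_latG_lattice _ _).2.2.2, ← h₂, ((L (cls b)).latU_latP_latG_lattice _ _).2.2.2]
    push_cast; ring
  · have hcb : chartChoiceAt L cls ((r : ℂ) • v) b = false := by
      simp [chartChoiceAt, Pi.smul_apply, smul_eq_mul, hr]
    rw [hcb, zetaHat_false, zetaHat_false, tc.mul_coord q r b, (L (cls b)).weierstrassZeta_add_period]


omit [Fintype β] [Fintype δ] [DecidableEq γ] in
omit [Fintype 𝓙] [DecidableEq 𝓙] in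
/-- **Fibre generators at multiples**: `Ñ_e(s·v) = q·Ñ_e(N·v) + Ñ_e(r·v)` for `s = qN + r`.
[cite: BakerWustholz2007, §6.8 (p. 119)] -/
theorem genFun_fibre_mul (tc : TorsionCoords L cls v N) (x : β ⊕ (γ ⊕ δ) → ℂ) (q r : ℕ) (e : δ) :
    genFun L cls κM (chartChoiceAt L cls (((q * N + r : ℕ) : ℂ) • v)) (((q * N + r : ℕ) : ℂ) • v) x 0
        (Sum.inr (Sum.inr e)) =
      q * genFun L cls κM (chartChoiceAt L cls ((N : ℂ) • v)) ((N : ℂ) • v) x 0 (Sum.inr (Sum.inr e)) +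
        genFun L cls κM (chartChoiceAt L cls ((r : ℂ) • v)) ((r : ℂ) • v) x 0 (Sum.inr (Sum.inr e)) := by
  -- the `N·v` values: all factors in the origin chart, `ζ̂ = η(N z'_b)`
  have hN : ∀ b, zetaHat (L (cls b)) (chartChoiceAt L cls ((N : ℂ) • v) b) ((N : ℂ) * v (iz b)) =
      (tc.m b : ℂ) * (L (cls b)).η₁ + (tc.n b : ℂ) * (L (cls b)).η₂ := fun b => by
    have hmem : (N : ℂ) * v (iz b) ∈ (L (cls b)).lattice := by
      rw [tc.eq b]; exact (L (cls b)).int_mul_add_int_mul_mem_lattice _ _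
    have hcb : chartChoiceAt L cls ((N : ℂ) • v) b = true := by
      simp [chartChoiceAt, Pi.smul_apply, smul_eq_mul, hmem]
    rw [hcb, zetaHat_true, tc.eq b, ((L (cls b)).latU_latP_latG_lattice _ _).2.2.2]
  simp only [genFun, Pi.smul_apply, smul_eq_mul, zero_mul, add_zero]
  have hb : ∀ b, (κM e b : ℂ) * zetaHat (L (cls b)) (chartChoiceAt L cls (((q * N + r : ℕ) : ℂ) • v) b)
      (((q * N + r : ℕ) : ℂ) * v (iz b)) =
      q * ((κM e b : ℂ) * zetaHat (L (cls b)) (chartChoiceAt L cls ((N : ℂ) • v) b) ((N : ℂ) * v (iz b))) +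
        (κM e b : ℂ) * zetaHat (L (cls b)) (chartChoiceAt L cls ((r : ℂ) • v) b) ((r : ℂ) * v (iz b)) := fun b => by
    rw [zetaHat_mul tc q r b, hN b]; push_cast; ring
  rw [Finset.sum_congr rfl fun b _ => hb b, Finset.sum_add_distrib, ← Finset.mul_sum]
  push_cast; ring


omit [Fintype β] [Fintype δ] in
omit [Fintype 𝓙] [DecidableEq 𝓙] in
/-- **Bridge from `Std.AlgTors`.** A point with torsion `E`-coordinates (per-coordinate orders
`N_b ≥ 1`) has `TorsionCoords` for the common order `N = ∏_b N_b > 0`. [folklore] -/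
theorem torsionCoords_of_mem_algTors {w : β ⊕ (γ ⊕ δ) → ℂ} (hw : w ∈ AlgTors L cls κM) :
    ∃ N : ℕ, 0 < N ∧ Nonempty (TorsionCoords L cls w N) := by
  classical
  obtain ⟨-, htors⟩ := hw
  choose Nb hNb hmem using htors
  refine ⟨∏ b, Nb b, Finset.prod_pos fun b _ => hNb b, ?_⟩
  have hl : ∀ b, ((∏ b', Nb b' : ℕ) : ℂ) * w (iz b) ∈ (L (cls b)).lattice := fun b => by
    rw [← Finset.mul_prod_erase Finset.univ Nb (Finset.mem_univ b)]
    push_cast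
    rw [mul_comm ((Nb b : ℂ)), mul_assoc]
    have := (L (cls b)).lattice.smul_mem ((∏ b' ∈ Finset.univ.erase b, Nb b' : ℕ) : ℤ) (hmem b)
    simpa [zsmul_eq_mul] using this
  choose m n hmn using fun b => PeriodPair.mem_lattice.mp (hl b)
  exact ⟨⟨m, n, fun b => by rw [← hmn b]⟩⟩


end TorsionMultiples

/-! ### Multiples of algebraic points -/

section Multiples

variable {L cls}

omit [Fintype β] [Fintype δ] [DecidableEq γ] in
omit [Fintype 𝓙] [DecidableEq 𝓙] in
/-- **`Alg` is stable under natural multiples.** [folklore] -/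
theorem nsmul_mem_Alg (hL : ∀ i, IsAlgebraic ℚ (L i).g₂ ∧ IsAlgebraic ℚ (L i).g₃) {w : β ⊕ (γ ⊕ δ) → ℂ}
    (hw : w ∈ Alg L cls κM) (n : ℕ) : ((n : ℂ) • w) ∈ Alg L cls κM := by
  obtain ⟨hy, t', hzt, hs⟩ := hw
  refine ⟨fun j => ?_, fun b => n * t' b, fun b => ?_, fun e => ?_⟩
  · -- torus: `e^{n y} = (e^y)^n`
    have : cexp (((n : ℂ) • w) (iy j)) = cexp (w (iy j)) ^ n := by
      simp [← Complex.exp_nat_mul]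
    rw [this]
    exact (hy j).pow n
  · have := (hzt b).int_mul ((hL (cls b)).1) ((hL (cls b)).2) (n : ℤ)
    simpa using this
  · have : ((n : ℂ) • w) (is e) - ∑ b, (κM e b : ℂ) * (n * t' b) =
        (n : ℂ) * (w (is e) - ∑ b, (κM e b : ℂ) * t' b) := by
      simp only [Pi.smul_apply, smul_eq_mul, Finset.mul_sum, mul_sub]
      congr 1
      exact Finset.sum_congr rfl fun b _ => by ring
    rw [this]
    exact (isAlgebraic_nat n).mul (hs e)


omit [Fintype β] [Fintype δ] [DecidableEq γ] in
omit [Fintype 𝓙] [DecidableEq 𝓙] in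
/-- `AlgTors` is stable under natural multiples. [folklore] -/
theorem nsmul_mem_AlgTors (hL : ∀ i, IsAlgebraic ℚ (L i).g₂ ∧ IsAlgebraic ℚ (L i).g₃) {w : β ⊕ (γ ⊕ δ) → ℂ}
    (hw : w ∈ AlgTors L cls κM) (n : ℕ) : ((n : ℂ) • w) ∈ AlgTors L cls κM := by
  refine ⟨nsmul_mem_Alg κM hL hw.1 n, fun b => ?_⟩
  have := (hw.2 b).int_mul (n : ℤ)
  simpa using this


omit [Fintype β] [Fintype δ] in
omit [Fintype 𝓙] [DecidableEq 𝓙] in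
/-- **All generator values at all multiples of an algebraic point are algebraic** (adapted
charts). [cite: BakerWustholz2007, §6.8 (p. 119)] -/
theorem isAlgebraic_genFun_zero_nsmul (hL : ∀ i, IsAlgebraic ℚ (L i).g₂ ∧ IsAlgebraic ℚ (L i).g₃)
    {v : β ⊕ (γ ⊕ δ) → ℂ} (hv : v ∈ Alg L cls κM) (s : ℕ) (x : β ⊕ (γ ⊕ δ) → ℂ) (i : Gen β γ δ) :
    IsAlgebraic ℚ (genFun L cls κM (chartChoiceAt L cls ((s : ℂ) • v)) ((s : ℂ) • v) x 0 i) :=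
  isAlgebraic_genFun_zero L cls κM hL _ (nsmul_mem_Alg κM hL hv s) x
    (zero_mem_chartDomain_chartChoiceAt L cls _ x) i


end Multiples

/-! ### The data of Baker's method on `M` and its number field -/

section Field

/-- **The data of Baker's method on `M_κ`**: algebraic invariants, a point of `Std.Alg` with
`N`-torsion `E`-coordinates (`N > 0`) and finitely many directions with algebraic coordinates.
[cite: BakerWustholz2007, §6.8] -/
structure BakerData (𝓙 β γ δ : Type) [Fintype 𝓙] [DecidableEq 𝓙] [Fintype β] [Fintype γ]
    [Fintype δ] [DecidableEq γ] where
  /-- the period pairs of the `E_i` -/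
  L : 𝓙 → PeriodPair
  /-- the class map of the blocks -/
  cls : γ → 𝓙
  /-- the extension data of `M` -/
  κM : δ → γ → Kbar
  /-- `g₂(Λ_i), g₃(Λ_i) ∈ ℚ̄` -/
  hL : ∀ i, IsAlgebraic ℚ (L i).g₂ ∧ IsAlgebraic ℚ (L i).g₃
  /-- the point -/
  v : β ⊕ (γ ⊕ δ) → ℂ
  /-- it is the logarithm of an algebraic point -/
  hv : v ∈ Alg L cls κM
  /-- common torsion order of the `E`-coordinates -/
  N : ℕ
  /-- `N > 0` -/
  hN : 0 < N
  /-- lattice coordinates of `N z'_b(v)` -/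
  tc : TorsionCoords L cls v N
  /-- number of directions -/
  dd : ℕ
  /-- the directions -/
  xs : Fin dd → β ⊕ (γ ⊕ δ) → ℂ
  /-- their coordinates are algebraic -/
  hxs : ∀ m k, IsAlgebraic ℚ (xs m k)


namespace BakerData

variable (B : BakerData 𝓙 β γ δ)

/-- Index type of the algebraic data generating the field `K`. [folklore] -/
inductive BIdx (B : BakerData 𝓙 β γ δ) : Type
  | g2 : 𝓙 → BIdx B
  | g3 : 𝓙 → BIdx B
  | kap : δ → γ → BIdx B
  | dir : Fin B.dd → β ⊕ (γ ⊕ δ) → BIdx B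
  | tor : β → BIdx B
  | fac : Fin B.N → γ → Fin 2 → BIdx B
  | fib : Fin (B.N + 1) → δ → BIdx B


/-- The index type is finite. [folklore] -/
instance instFintypeBIdx : Fintype B.BIdx := by
  classical
  exact Fintype.ofEquiv
    ((𝓙 × Fin 2) ⊕ (δ × γ) ⊕ (Fin B.dd × (β ⊕ (γ ⊕ δ))) ⊕ β ⊕ (Fin B.N × γ × Fin 2) ⊕
      (Fin (B.N + 1) × δ))
    { toFun := fun t => match t with
        | Sum.inl ⟨i, 0⟩ => BIdx.g2 i
        | Sum.inl ⟨i, 1⟩ => BIdx.g3 i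
        | Sum.inr (Sum.inl ⟨e, b⟩) => BIdx.kap e b
        | Sum.inr (Sum.inr (Sum.inl ⟨m, k⟩)) => BIdx.dir m k
        | Sum.inr (Sum.inr (Sum.inr (Sum.inl j))) => BIdx.tor j
        | Sum.inr (Sum.inr (Sum.inr (Sum.inr (Sum.inl ⟨r, b, i⟩)))) => BIdx.fac r b i
        | Sum.inr (Sum.inr (Sum.inr (Sum.inr (Sum.inr ⟨r, e⟩)))) => BIdx.fib r e
      invFun := fun t => match t with
        | BIdx.g2 i => Sum.inl ⟨i, 0⟩
        | BIdx.g3 i => Sum.inl ⟨i, 1⟩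
        | BIdx.kap e b => Sum.inr (Sum.inl ⟨e, b⟩)
        | BIdx.dir m k => Sum.inr (Sum.inr (Sum.inl ⟨m, k⟩))
        | BIdx.tor j => Sum.inr (Sum.inr (Sum.inr (Sum.inl j)))
        | BIdx.fac r b i => Sum.inr (Sum.inr (Sum.inr (Sum.inr (Sum.inl ⟨r, b, i⟩))))
        | BIdx.fib r e => Sum.inr (Sum.inr (Sum.inr (Sum.inr (Sum.inr ⟨r, e⟩))))
      left_inv := fun t => by
        rcases t with ⟨_, i⟩ | ⟨_, _⟩ | ⟨_, _⟩ | _ | ⟨_, _, _⟩ | ⟨_, _⟩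
        · fin_cases i <;> rfl
        all_goals rfl
      right_inv := fun t => by cases t <;> rfl }


/-- The generator value at `r·v` in the adapted chart (independent of the direction argument,
which only enters at `ξ ≠ 0`). [folklore] -/
def genAt (r : ℕ) (i : Gen β γ δ) : ℂ :=
  genFun B.L B.cls B.κM (chartChoiceAt B.L B.cls ((r : ℂ) • B.v)) ((r : ℂ) • B.v) 0 0 i


omit [Fintype β] [Fintype δ] [DecidableEq γ] in
omit [Fintype 𝓙] [DecidableEq 𝓙] in
/-- At `ξ = 0` the generator values do not depend on the direction. [folklore] -/
theorem genFun_zero_eq_genFun_zero (L : 𝓙 → PeriodPair) (cls : γ → 𝓙) (κM : δ → γ → Kbar) (c : γ → Bool)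
    (w x : β ⊕ (γ ⊕ δ) → ℂ) (i : Gen β γ δ) :
    genFun L cls κM c w x 0 i = genFun L cls κM c w 0 0 i := by
  rcases i with j | ⟨b, i⟩ | e <;> simp [genFun]


/-- The algebraic data. [folklore] -/
def aVal : B.BIdx → ℂ
  | BIdx.g2 i => (B.L i).g₂
  | BIdx.g3 i => (B.L i).g₃
  | BIdx.kap e b => (B.κM e b : ℂ)
  | BIdx.dir m k => B.xs m k
  | BIdx.tor j => cexp (B.v (iy j))
  | BIdx.fac r b i => B.genAt r (Sum.inr (Sum.inl (b, i)))
  | BIdx.fib r e => B.genAt r (Sum.inr (Sum.inr e))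


/-- All the data are algebraic. [folklore] -/
theorem isAlgebraic_aVal (t : B.BIdx) : IsAlgebraic ℚ (B.aVal t) := by
  cases t with
  | g2 i => exact (B.hL i).1
  | g3 i => exact (B.hL i).2
  | kap e b => exact isAlgebraic_coe_Kbar _
  | dir m k => exact B.hxs m k
  | tor j => exact B.hv.1 j
  | fac r b i =>
    exact isAlgebraic_genFun_zero_nsmul B.κM B.hL B.hv r 0 (Sum.inr (Sum.inl (b, i)))
  | fib r e =>
    exact isAlgebraic_genFun_zero_nsmul B.κM B.hL B.hv r 0 (Sum.inr (Sum.inr e))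


/-- **The finite family of algebraic numbers of Baker's method on `M_κ`.** [cite: BakerWustholz2007, §6.8] -/
def gens : AlgGens := ⟨B.BIdx, B.aVal, B.isAlgebraic_aVal⟩


/-- The number field `K`. [cite: BakerWustholz2007, §6.8] -/
abbrev K : IntermediateField ℚ ℂ := B.gens.K


/-- The inclusion `K ⊂ ℂ` as a ring map. [folklore] -/
abbrev emb : B.K →+* ℂ := algebraMap B.K ℂ


/-- The `K`-valued datum with index `t`. [folklore] -/
abbrev gK' (t : B.BIdx) : B.K := B.gens.genK t


/-- `emb (gK' t) = aVal t`. [folklore] -/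
@[simp] theorem emb_gK' (t : B.BIdx) : B.emb (B.gK' t) = B.aVal t := rfl


/-- `s mod N` as an element of `Fin N`. [folklore] -/
def rmod (s : ℕ) : Fin B.N := ⟨s % B.N, Nat.mod_lt _ B.hN⟩


/-- `s mod N` as an element of `Fin (N+1)`. [folklore] -/
def rmod' (s : ℕ) : Fin (B.N + 1) := ⟨s % B.N, (Nat.mod_lt _ B.hN).trans (Nat.lt_succ_self _)⟩


/-- `N` as an element of `Fin (N+1)`. [folklore] -/
def topN : Fin (B.N + 1) := ⟨B.N, Nat.lt_succ_self _⟩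


/-- **The generator values at `s·v` as elements of `K`.** [cite: BakerWustholz2007, §6.8 (p. 119)] -/
def gK (s : ℕ) : Gen β γ δ → B.K
  | Sum.inl j => B.gK' (BIdx.tor j) ^ s
  | Sum.inr (Sum.inl (b, i)) => B.gK' (BIdx.fac (B.rmod s) b i)
  | Sum.inr (Sum.inr e) => ((s / B.N : ℕ) : B.K) * B.gK' (BIdx.fib B.topN e) + B.gK' (BIdx.fib (B.rmod' s) e)


/-- **`gK s` are the generator values at `s·v`** (adapted chart, any direction). [folklore] -/
theorem emb_gK (s : ℕ) (x : β ⊕ (γ ⊕ δ) → ℂ) (i : Gen β γ δ) :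
    B.emb (B.gK s i) = genFun B.L B.cls B.κM (chartChoiceAt B.L B.cls ((s : ℂ) • B.v)) ((s : ℂ) • B.v) x 0 i := by
  have hs : ((s / B.N * B.N + s % B.N : ℕ) : ℂ) = s := by rw [Nat.div_add_mod']
  rcases i with j | ⟨b, i⟩ | e
  · simp only [gK, map_pow, emb_gK', aVal]
    rw [genFun_torus_mul]
  · simp only [gK, emb_gK', aVal, genAt, rmod]
    rw [genFun_zero_eq_genFun_zero _ _ _ _ _ x, ← hs, genFun_factor_mul B.κM B.tc]
  · simp only [gK, map_add, map_mul, map_natCast, emb_gK', aVal, genAt, rmod', topN]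
    rw [genFun_zero_eq_genFun_zero _ _ _ _ _ x, ← hs, genFun_fibre_mul B.κM B.tc]


/-- The common denominator of the data. [folklore] -/
abbrev den : ℤ := B.gens.den


/-- **Denominators at `s·v`**: `den^{s+1} · gK s i ∈ 𝓞_K`. [cite: BakerWustholz2007, §6.8 (p. 119)] -/
theorem isIntegral_den_pow_mul_gK (s : ℕ) (i : Gen β γ δ) :
    IsIntegral ℤ ((B.den : B.K) ^ (s + 1) * B.gK s i) := by
  have hd : IsIntegral ℤ (B.den : B.K) := isIntegral_intCast (B := B.K) _
  have hg : ∀ t, IsIntegral ℤ ((B.den : B.K) * B.gK' t) := B.gens.isIntegral_den_mul_genK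
  rcases i with j | ⟨b, i⟩ | e
  · simp only [gK]
    have e1 : (B.den : B.K) ^ (s + 1) * B.gK' (BIdx.tor j) ^ s =
        (B.den : B.K) * ((B.den : B.K) * B.gK' (BIdx.tor j)) ^ s := by
      rw [mul_pow, pow_succ]; ring
    rw [e1]
    exact hd.mul ((hg _).pow _)
  · simp only [gK]
    rw [pow_succ, mul_assoc]
    exact (hd.pow _).mul (hg _)
  · simp only [gK]
    have hq : IsIntegral ℤ ((s / B.N : ℕ) : B.K) := by
      exact_mod_cast isIntegral_intCast (B := B.K) ((s / B.N : ℕ) : ℤ)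
    have e1 : (B.den : B.K) ^ (s + 1) *
        (((s / B.N : ℕ) : B.K) * B.gK' (BIdx.fib B.topN e) + B.gK' (BIdx.fib (B.rmod' s) e)) =
        (B.den : B.K) ^ s * (((s / B.N : ℕ) : B.K) * ((B.den : B.K) * B.gK' (BIdx.fib B.topN e)) +
          (B.den : B.K) * B.gK' (BIdx.fib (B.rmod' s) e)) := by
      rw [pow_succ]; ring
    rw [e1]
    exact (hd.pow _).mul ((hq.mul (hg _)).add (hg _))


/-- The conjugate bound of the data (`≥ 1`). [folklore] -/
abbrev M : ℝ := B.gens.M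


/-- **Conjugates at `s·v`**: `|σ(gK s i)| ≤ (s+1)·M^{s+1}` for every embedding `σ : K → ℂ`.
[cite: BakerWustholz2007, §6.8 (p. 119: log max |f_i(sv)| ≪ s)] -/
theorem norm_embedding_gK_le (σ : B.K →+* ℂ) (s : ℕ) (i : Gen β γ δ) :
    ‖σ (B.gK s i)‖ ≤ (s + 1) * B.M ^ (s + 1) := by
  have hM : 1 ≤ B.M := B.gens.one_le_M
  have hg : ∀ t, ‖σ (B.gK' t)‖ ≤ B.M := B.gens.norm_embedding_genK_le σ
  have hM0 : 0 ≤ B.M := zero_le_one.trans hM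
  have h1 : (1 : ℝ) ≤ (s + 1) := by
    have : (0 : ℝ) ≤ s := Nat.cast_nonneg s
    linarith
  rcases i with j | ⟨b, i⟩ | e
  · simp only [gK, map_pow, norm_pow]
    calc ‖σ (B.gK' (BIdx.tor j))‖ ^ s ≤ B.M ^ s := pow_le_pow_left₀ (norm_nonneg _) (hg _) s
      _ ≤ B.M ^ (s + 1) := pow_le_pow_right₀ hM (Nat.le_succ s)
      _ ≤ (s + 1) * B.M ^ (s + 1) := le_mul_of_one_le_left (pow_nonneg hM0 _) h1
  · simp only [gK]
    calc ‖σ (B.gK' (BIdx.fac (B.rmod s) b i))‖ ≤ B.M := hg _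
      _ = B.M ^ 1 := (pow_one _).symm
      _ ≤ B.M ^ (s + 1) := pow_le_pow_right₀ hM (Nat.succ_le_succ (Nat.zero_le s))
      _ ≤ (s + 1) * B.M ^ (s + 1) := le_mul_of_one_le_left (pow_nonneg hM0 _) h1
  · simp only [gK, map_add, map_mul, map_natCast]
    have hq : ((s / B.N : ℕ) : ℝ) ≤ s := by exact_mod_cast Nat.div_le_self s B.N
    calc ‖((s / B.N : ℕ) : ℂ) * σ (B.gK' (BIdx.fib B.topN e)) + σ (B.gK' (BIdx.fib (B.rmod' s) e))‖
        ≤ ‖((s / B.N : ℕ) : ℂ) * σ (B.gK' (BIdx.fib B.topN e))‖ + ‖σ (B.gK' (BIdx.fib (B.rmod' s) e))‖ :=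
          norm_add_le _ _
      _ ≤ (s : ℝ) * B.M + B.M := by
          rw [norm_mul, Complex.norm_natCast]
          exact add_le_add (mul_le_mul hq (hg _) (norm_nonneg _) (Nat.cast_nonneg s)) (hg _)
      _ = (s + 1) * B.M ^ 1 := by ring
      _ ≤ (s + 1) * B.M ^ (s + 1) :=
          mul_le_mul_of_nonneg_left (pow_le_pow_right₀ hM (Nat.succ_le_succ (Nat.zero_le s)))
            (zero_le_one.trans h1)


end BakerData

end Field

/-! ### The `K`-models of the line derivations and chart polynomials -/

section Models

open Literature.NumberTheory.Transcendental.ArithPoly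
open GaGmE.Std.BakerData (degX degX2 degCXX totalDegree_factorODEᵣ_le totalDegree_zetaHatODEᵣ_le)

namespace BakerData

variable (B : BakerData 𝓙 β γ δ)

/-- Integrality over `ℤ` in `K`, with the `ℤ`-algebra structure pinned to `Ring.toIntAlgebra` (the
one used by `ArithPoly.IsDenInt` and `AlgebraicGeneratorsField`; the intermediate field also
carries the propositionally equal `IntermediateField.algebra'`). [folklore] -/
abbrev IntZ (x : B.K) : Prop := @IsIntegral ℤ B.K _ _ (Ring.toIntAlgebra _) x


/-- `g₂(Λ_i) ∈ K`. [folklore] -/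
abbrev g2K (i : 𝓙) : B.K := B.gK' (BIdx.g2 i)

/-- `g₃(Λ_i) ∈ K`. [folklore] -/
abbrev g3K (i : 𝓙) : B.K := B.gK' (BIdx.g3 i)

/-- `κ_{eb} ∈ K`. [folklore] -/
abbrev κK (e : δ) (b : γ) : B.K := B.gK' (BIdx.kap e b)

/-- the coordinates of the directions in `K`. [folklore] -/
abbrev xK (m : Fin B.dd) (k : β ⊕ (γ ⊕ δ)) : B.K := B.gK' (BIdx.dir m k)


/-- **The `K`-model of the line derivation data** for the chart choice `c` and direction `x_m`.
[folklore] -/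
def QK (c : γ → Bool) (m : Fin B.dd) : Gen β γ δ → MvPolynomial (Gen β γ δ) B.K :=
  genODEᵣ B.cls B.g2K B.g3K B.κK c (B.xK m)


/-- **The `K`-model of the chart polynomials** for the chart choice `c`. [folklore] -/
def HK (c : γ → Bool) : Option β × ThetaIdx γ δ → MvPolynomial (Gen β γ δ) B.K :=
  HPolyᵣ B.cls B.g2K B.g3K B.κK c


/-- `QK` maps to `genODE`. [folklore] -/
theorem map_QK (c : γ → Bool) (m : Fin B.dd) (i : Gen β γ δ) :
    map B.emb (B.QK c m i) = genODE B.L B.cls B.κM c (B.xs m) i := by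
  rw [QK, map_genODEᵣ]
  exact congrFun (genODEᵣ_complex B.L B.cls B.κM c (B.xs m)) i


/-- `HK` maps to `HPoly`. [folklore] -/
theorem map_HK (c : γ → Bool) (J : Option β × ThetaIdx γ δ) :
    map B.emb (B.HK c J) = HPoly B.L B.cls B.κM c J := by
  rw [HK, map_HPolyᵣ]
  exact congrFun (HPolyᵣ_complex (β := β) B.L B.cls B.κM c) J


section Deg

variable {R : Type*} [Field R]

omit [Fintype β] [Fintype δ] [DecidableEq γ] in
omit [Fintype 𝓙] [DecidableEq 𝓙] in
/-- **The line derivation data have degree `≤ 2`.** [folklore] -/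
theorem totalDegree_genODEᵣ_le (g2 g3 : 𝓙 → R) (κ : δ → γ → R) (c : γ → Bool)
    (x : β ⊕ (γ ⊕ δ) → R) (i : Gen β γ δ) :
    (genODEᵣ cls g2 g3 κ c x i).totalDegree ≤ 2 := by
  rcases i with j | ⟨b, i⟩ | e
  · exact (totalDegree_C_mul_le _ _).trans ((degX _).trans (by norm_num))
  · exact (totalDegree_C_mul_le _ _).trans (totalDegree_factorODEᵣ_le _ _ _ _ _)
  · refine (totalDegree_sub _ _).trans (max_le (by rw [totalDegree_C]; norm_num) ?_)
    refine (totalDegree_finsetSum _ _).trans (Finset.sup_le fun b _ => ?_)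
    exact (totalDegree_C_mul_le _ _).trans (totalDegree_zetaHatODEᵣ_le _ _ _ _)


end Deg

/-- `deg QK ≤ 2`. [folklore] -/
theorem totalDegree_QK_le (c : γ → Bool) (m : Fin B.dd) (i : Gen β γ δ) : (B.QK c m i).totalDegree ≤ 2 :=
  totalDegree_genODEᵣ_le _ _ _ _ _ _ _


/-- The working denominator `d₁ = 2·den` (the explicit formulas involve halves). [folklore] -/
abbrev d₁ : ℤ := 2 * B.den


/-- `d₁ · (datum) ∈ 𝓞_K`. [folklore] -/
theorem isIntegral_d₁_mul_gK' (t : B.BIdx) : B.IntZ ((B.d₁ : B.K) * B.gK' t) := by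
  have h := B.gens.isIntegral_den_mul_genK t
  have e : ((B.d₁ : ℤ) : B.K) * B.gK' t = (2 : B.K) * ((B.den : B.K) * B.gK' t) := by
    simp only [d₁, Int.cast_mul, Int.cast_ofNat]; ring
  show IsIntegral ℤ _
  rw [e]
  exact (isIntegral_intCast (B := B.K) 2).mul h


/-- `d₁ · (datum / 2) ∈ 𝓞_K`. [folklore] -/
theorem isIntegral_d₁_mul_half_gK' (t : B.BIdx) : B.IntZ ((B.d₁ : B.K) * (B.gK' t / 2)) := by
  have h := B.gens.isIntegral_den_mul_genK t
  have e : ((B.d₁ : ℤ) : B.K) * (B.gK' t / 2) = (B.den : B.K) * B.gK' t := by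
    simp only [d₁, Int.cast_mul, Int.cast_ofNat]; field_simp
  show IsIntegral ℤ _
  rwa [e]


/-- `d₁ · (n · datum / 2) ∈ 𝓞_K` for an integer `n`. [folklore] -/
theorem isIntegral_d₁_mul_int_mul_half_gK' (n : ℤ) (t : B.BIdx) :
    B.IntZ ((B.d₁ : B.K) * (n * B.gK' t / 2)) := by
  have h := B.isIntegral_d₁_mul_half_gK' t
  have e : ((B.d₁ : ℤ) : B.K) * (n * B.gK' t / 2) = (n : B.K) * ((B.d₁ : B.K) * (B.gK' t / 2)) := by ring
  show IsIntegral ℤ _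
  rw [e]
  exact (isIntegral_intCast (B := B.K) n).mul h


/-- `d₁ · (n · datum) ∈ 𝓞_K` for an integer `n`. [folklore] -/
theorem isIntegral_d₁_mul_int_mul_gK' (n : ℤ) (t : B.BIdx) :
    B.IntZ ((B.d₁ : B.K) * (n * B.gK' t)) := by
  have e : ((B.d₁ : ℤ) : B.K) * (n * B.gK' t) = (n : B.K) * ((B.d₁ : B.K) * B.gK' t) := by ring
  show IsIntegral ℤ _
  rw [e]
  exact (isIntegral_intCast (B := B.K) n).mul (B.isIntegral_d₁_mul_gK' t)


/-- `d₁ · (-1/2) ∈ 𝓞_K`. [folklore] -/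
theorem isIntegral_d₁_mul_neg_half : B.IntZ ((B.d₁ : B.K) * (-1 / 2)) := by
  have e : ((B.d₁ : ℤ) : B.K) * (-1 / 2) = ((-B.den : ℤ) : B.K) := by
    simp only [d₁, Int.cast_mul, Int.cast_ofNat, Int.cast_neg]; field_simp
  show IsIntegral ℤ _
  rw [e]; exact isIntegral_intCast (B := B.K) _


/-- `d₁ · (1/2) ∈ 𝓞_K`. [folklore] -/
theorem isIntegral_d₁_mul_half : B.IntZ ((B.d₁ : B.K) * (1 / 2)) := by
  have e : ((B.d₁ : ℤ) : B.K) * (1 / 2) = ((B.den : ℤ) : B.K) := by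
    simp only [d₁, Int.cast_mul, Int.cast_ofNat]; field_simp
  show IsIntegral ℤ _
  rw [e]; exact isIntegral_intCast (B := B.K) _


section DenHelpers

variable {e : ℕ}

/-- A constant with denominator `d₁`. [folklore] -/
theorem isDenInt_C_of {a : B.K} (h : B.IntZ ((B.d₁ : B.K) * a)) :
    IsDenInt B.d₁ 1 (C a : MvPolynomial (Gen β γ δ) B.K) :=
  IsDenInt.C (by simpa using h)


/-- Variables. [folklore] -/
theorem isDenInt_X (k : Gen β γ δ) (e : ℕ) : IsDenInt B.d₁ e (X k : MvPolynomial (Gen β γ δ) B.K) :=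
  (IsDenInt.X k).mono (Nat.zero_le e)


/-- Squares of variables. [folklore] -/
theorem isDenInt_X_sq (k : Gen β γ δ) (e : ℕ) : IsDenInt B.d₁ e ((X k : MvPolynomial (Gen β γ δ) B.K) ^ 2) := by
  have := (IsDenInt.X (d := B.d₁) (K := B.K) k).pow 2
  exact this.mono (Nat.zero_le e)


end DenHelpers

/-- **`d₁ · factorODEᵣ` has integral coefficients.** [folklore] -/
theorem isDenInt_factorODEᵣ (t2 t3 : B.BIdx) (lat : Bool) (b : γ) (i : Fin 2) :
    IsDenInt B.d₁ 1 (factorODEᵣ (β := β) (δ := δ) (B.gK' t2) (B.gK' t3) lat b i) := by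
  have hg2h : IsDenInt B.d₁ 1 (C (B.gK' t2 / 2) : MvPolynomial (Gen β γ δ) B.K) :=
    B.isDenInt_C_of (B.isIntegral_d₁_mul_half_gK' _)
  have hg2 : IsDenInt B.d₁ 1 (C (B.gK' t2) : MvPolynomial (Gen β γ δ) B.K) :=
    B.isDenInt_C_of (B.isIntegral_d₁_mul_gK' _)
  have hg3h : IsDenInt B.d₁ 1 (C (3 * B.gK' t3 / 2) : MvPolynomial (Gen β γ δ) B.K) :=
    B.isDenInt_C_of (by simpa using B.isIntegral_d₁_mul_int_mul_half_gK' 3 t3)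
  have hhalf : IsDenInt B.d₁ 1 (C (-1 / 2) : MvPolynomial (Gen β γ δ) B.K) :=
    B.isDenInt_C_of B.isIntegral_d₁_mul_neg_half
  have h6 : IsDenInt B.d₁ 1 (6 : MvPolynomial (Gen β γ δ) B.K) := (IsDenInt.ofNat _ 6).mono (Nat.zero_le 1)
  cases lat <;> fin_cases i <;>
    simp only [factorODEᵣ, Bool.false_eq_true, if_false, if_true, Fin.zero_eta, Fin.mk_one, Fin.isValue,
      Matrix.cons_val_zero, Matrix.cons_val_one, Matrix.cons_val_fin_one]
  · exact B.isDenInt_X _ 1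
  · exact (h6.mul (B.isDenInt_X_sq _ 0)).sub hg2h
  · rw [neg_mul]
    exact (h6.mul (B.isDenInt_X_sq _ 0)).neg.add (hg2h.mul (B.isDenInt_X_sq _ 0))
  · exact (hhalf.sub ((hg2.mul (B.isDenInt_X _ 0)).mul (B.isDenInt_X _ 0))).sub
      (hg3h.mul (B.isDenInt_X_sq _ 0))


/-- **`d₁ · zetaHatODEᵣ` has integral coefficients.** [folklore] -/
theorem isDenInt_zetaHatODEᵣ (t2 t3 : B.BIdx) (lat : Bool) (b : γ) :
    IsDenInt B.d₁ 1 (zetaHatODEᵣ (β := β) (δ := δ) (B.gK' t2) (B.gK' t3) lat b) := by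
  have h2g2 : IsDenInt B.d₁ 1 (C (2 * B.gK' t2) : MvPolynomial (Gen β γ δ) B.K) :=
    B.isDenInt_C_of (by simpa using B.isIntegral_d₁_mul_int_mul_gK' 2 t2)
  have h3g3 : IsDenInt B.d₁ 1 (C (3 * B.gK' t3) : MvPolynomial (Gen β γ δ) B.K) :=
    B.isDenInt_C_of (by simpa using B.isIntegral_d₁_mul_int_mul_gK' 3 t3)
  cases lat <;> simp only [zetaHatODEᵣ, Bool.false_eq_true, if_false, if_true]
  · exact (B.isDenInt_X _ 1).neg
  · rw [neg_mul]
    exact (h2g2.mul (B.isDenInt_X_sq _ 0)).neg.sub ((h3g3.mul (B.isDenInt_X _ 0)).mul (B.isDenInt_X _ 0))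


/-- **`d₁³ · QK` has integral coefficients.** [folklore] -/
theorem isDenInt_QK (c : γ → Bool) (m : Fin B.dd) (i : Gen β γ δ) : IsDenInt B.d₁ 3 (B.QK c m i) := by
  have hx : ∀ k, IsDenInt B.d₁ 1 (C (B.xK m k) : MvPolynomial (Gen β γ δ) B.K) := fun k =>
    B.isDenInt_C_of (B.isIntegral_d₁_mul_gK' _)
  have hκx : ∀ e b, IsDenInt B.d₁ 2 (C (B.κK e b * B.xK m (iz b)) : MvPolynomial (Gen β γ δ) B.K) := by
    intro e b
    rw [C_mul]
    exact (B.isDenInt_C_of (B.isIntegral_d₁_mul_gK' _)).mul (hx _)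
  rcases i with j | ⟨b, i⟩ | e
  · exact ((hx _).mul (B.isDenInt_X _ 0)).mono (by norm_num)
  · show IsDenInt B.d₁ 3 (C (B.xK m (iz b)) *
      factorODEᵣ (B.g2K (B.cls b)) (B.g3K (B.cls b)) (c b) b i)
    exact ((hx _).mul (B.isDenInt_factorODEᵣ _ _ _ _ _)).mono (by norm_num)
  · show IsDenInt B.d₁ 3 (C (B.xK m (is e)) - ∑ b, C (B.κK e b * B.xK m (iz b)) *
      zetaHatODEᵣ (B.g2K (B.cls b)) (B.g3K (B.cls b)) (c b) b)
    refine ((hx _).mono (by norm_num)).sub (IsDenInt.sum fun b _ =>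
      IsDenInt.mul (e := 2) (e' := 1) (hκx e b) ?_)
    exact B.isDenInt_zetaHatODEᵣ _ _ _ _


/-- `rPolyᵣ` carries no denominator. [folklore] -/
theorem isDenInt_rPolyᵣ (lat : Bool) (b : γ) (i : Fin 3) :
    IsDenInt B.d₁ 0 (rPolyᵣ (β := β) (δ := δ) (R := B.K) lat b i) := by
  cases lat <;> fin_cases i <;>
    simp only [rPolyᵣ, Bool.false_eq_true, if_false, if_true, Fin.zero_eta, Fin.mk_one, Fin.isValue,
      Fin.reduceFinMk, Matrix.cons_val_zero, Matrix.cons_val_one, Matrix.cons_val] <;>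
    first | exact IsDenInt.one _ | exact IsDenInt.X _


/-- **`d₁ · corrPolyᵣ` has integral coefficients.** [folklore] -/
theorem isDenInt_corrPolyᵣ (t2 t3 : B.BIdx) (lat : Bool) (b : γ) (i : Fin 3) :
    IsDenInt B.d₁ 1 (corrPolyᵣ (β := β) (δ := δ) (B.gK' t2) (B.gK' t3) lat b i) := by
  have hg2h : IsDenInt B.d₁ 1 (C (B.gK' t2 / 2) : MvPolynomial (Gen β γ δ) B.K) :=
    B.isDenInt_C_of (B.isIntegral_d₁_mul_half_gK' _)
  have hg3h : IsDenInt B.d₁ 1 (C (B.gK' t3 / 2) : MvPolynomial (Gen β γ δ) B.K) :=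
    B.isDenInt_C_of (B.isIntegral_d₁_mul_half_gK' _)
  have hhalf : IsDenInt B.d₁ 1 (C (1 / 2) : MvPolynomial (Gen β γ δ) B.K) :=
    B.isDenInt_C_of B.isIntegral_d₁_mul_half
  have h2 : IsDenInt B.d₁ 1 (2 : MvPolynomial (Gen β γ δ) B.K) := (IsDenInt.ofNat _ 2).mono (Nat.zero_le 1)
  cases lat <;> fin_cases i <;>
    simp only [corrPolyᵣ, Bool.false_eq_true, if_false, if_true, Fin.zero_eta, Fin.mk_one, Fin.isValue,
      Fin.reduceFinMk, Matrix.cons_val_zero, Matrix.cons_val_one, Matrix.cons_val]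
  · exact IsDenInt.zero
  · exact IsDenInt.zero
  · exact h2.mul (B.isDenInt_X_sq _ 0)
  · rw [neg_mul]
    exact (h2.mul (B.isDenInt_X_sq _ 0)).neg
  · exact (hhalf.neg.sub ((hg2h.mul (B.isDenInt_X _ 0)).mul (B.isDenInt_X _ 0))).sub
      (hg3h.mul (B.isDenInt_X_sq _ 0))
  · exact IsDenInt.zero


/-- `TPolyᵣ` carries no denominator. [folklore] -/
theorem isDenInt_TPolyᵣ (a : Option β) : IsDenInt B.d₁ 0 (TPolyᵣ (γ := γ) (δ := δ) (R := B.K) a) := by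
  cases a
  · exact IsDenInt.one _
  · exact IsDenInt.X _


/-- **`d₁² · HK` has integral coefficients.** [folklore] -/
theorem isDenInt_HK (c : γ → Bool) (J : Option β × ThetaIdx γ δ) : IsDenInt B.d₁ 2 (B.HK c J) := by
  have hprod : ∀ (M : γ → Fin 3) (s : Finset γ),
      IsDenInt B.d₁ 0 (∏ b ∈ s, rPolyᵣ (β := β) (δ := δ) (R := B.K) (c b) b (M b)) := fun M s =>
    IsDenInt.prod_zero s fun b _ => B.isDenInt_rPolyᵣ _ _ _
  rcases J with ⟨a, M, _ | e⟩
  · show IsDenInt B.d₁ 2 (TPolyᵣ a * ∏ b, rPolyᵣ (c b) b (M b))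
    exact ((B.isDenInt_TPolyᵣ a).mul (hprod M Finset.univ)).mono (by norm_num)
  · show IsDenInt B.d₁ 2 (TPolyᵣ a * (X (Sum.inr (Sum.inr e)) * ∏ b, rPolyᵣ (c b) b (M b) -
        ∑ b, C (B.κK e b) * (corrPolyᵣ (B.g2K (B.cls b)) (B.g3K (B.cls b)) (c b) b (M b) *
          ∏ b' ∈ Finset.univ.erase b, rPolyᵣ (c b') b' (M b'))))
    refine ((B.isDenInt_TPolyᵣ a).mul (IsDenInt.sub (e := 2) ?_ ?_)).mono (by norm_num)
    · exact ((B.isDenInt_X _ 0).mul (hprod M Finset.univ)).mono (by norm_num)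
    · refine IsDenInt.sum fun b _ =>
        (B.isDenInt_C_of (B.isIntegral_d₁_mul_gK' _)).mul (IsDenInt.mul (e := 1) (e' := 0) ?_ (hprod M _))
      exact B.isDenInt_corrPolyᵣ _ _ _ _ _


end BakerData

end Models

/-! ### Siegel's lemma: entries, the linear system, the auxiliary function -/

section Siegel

open Finset NumberField
open Literature.NumberTheory.Transcendental.ArithPoly
open Literature.NumberTheory.Transcendental.Chudnovsky

namespace BakerData

variable (B : BakerData 𝓙 β γ δ)

/-- `‖·‖_σ 1 = 1` for the pullback seminorms. [folklore] -/
theorem embSeminorm_one_le (σ : B.K →+* ℂ) : embSeminorm σ 1 ≤ 1 := by simp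


/-- **A uniform bound for the sizes of the derivation data**:
`qB = ∑_{σ,c,m,i} ‖QK c m i‖_σ`. [folklore] -/
def qB : ℝ := ∑ σ : B.K →+* ℂ, ∑ c : γ → Bool, ∑ m : Fin B.dd, ∑ i : Gen β γ δ, wnorm (embSeminorm σ) (B.QK c m i)


/-- `qB ≥ 0`. [folklore] -/
theorem qB_nonneg : 0 ≤ B.qB :=
  Finset.sum_nonneg fun _ _ => Finset.sum_nonneg fun _ _ => Finset.sum_nonneg fun _ _ =>
    Finset.sum_nonneg fun _ _ => wnorm_nonneg _ _


/-- `‖QK c m i‖_σ ≤ qB`. [folklore] -/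
theorem wnorm_QK_le (σ : B.K →+* ℂ) (c : γ → Bool) (m : Fin B.dd) (i : Gen β γ δ) :
    wnorm (embSeminorm σ) (B.QK c m i) ≤ B.qB := by
  unfold qB
  refine le_trans ?_ (single_le_sum (f := fun σ' : B.K →+* ℂ => ∑ c : γ → Bool, ∑ m : Fin B.dd,
    ∑ i : Gen β γ δ, wnorm (embSeminorm σ') (B.QK c m i))
    (fun _ _ => Finset.sum_nonneg fun _ _ => Finset.sum_nonneg fun _ _ =>
      Finset.sum_nonneg fun _ _ => wnorm_nonneg _ _) (mem_univ σ))
  refine le_trans ?_ (single_le_sum (f := fun c' : γ → Bool => ∑ m : Fin B.dd,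
    ∑ i : Gen β γ δ, wnorm (embSeminorm σ) (B.QK c' m i))
    (fun _ _ => Finset.sum_nonneg fun _ _ => Finset.sum_nonneg fun _ _ => wnorm_nonneg _ _) (mem_univ c))
  refine le_trans ?_ (single_le_sum (f := fun m' : Fin B.dd =>
    ∑ i : Gen β γ δ, wnorm (embSeminorm σ) (B.QK c m' i))
    (fun _ _ => Finset.sum_nonneg fun _ _ => wnorm_nonneg _ _) (mem_univ m))
  exact single_le_sum (f := fun i' => wnorm (embSeminorm σ) (B.QK c m i')) (fun _ _ => wnorm_nonneg _ _)
    (mem_univ i)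


/-- **A uniform bound for the sizes of the chart polynomials**: `hB = 1 + ∑_{σ,c,J} ‖HK c J‖_σ`.
[folklore] -/
def hB : ℝ := 1 + ∑ σ : B.K →+* ℂ, ∑ c : γ → Bool, ∑ J : Option β × ThetaIdx γ δ, wnorm (embSeminorm σ) (B.HK c J)


/-- `1 ≤ hB`. [folklore] -/
theorem one_le_hB : 1 ≤ B.hB := by
  unfold hB
  have : 0 ≤ ∑ σ : B.K →+* ℂ, ∑ c : γ → Bool, ∑ J : Option β × ThetaIdx γ δ,
      wnorm (embSeminorm σ) (B.HK c J) :=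
    Finset.sum_nonneg fun _ _ => Finset.sum_nonneg fun _ _ => Finset.sum_nonneg fun _ _ => wnorm_nonneg _ _
  linarith


/-- `‖HK c J‖_σ ≤ hB`. [folklore] -/
theorem wnorm_HK_le (σ : B.K →+* ℂ) (c : γ → Bool) (J : Option β × ThetaIdx γ δ) :
    wnorm (embSeminorm σ) (B.HK c J) ≤ B.hB := by
  unfold hB
  have h1 : wnorm (embSeminorm σ) (B.HK c J) ≤ ∑ σ' : B.K →+* ℂ, ∑ c' : γ → Bool,
      ∑ J' : Option β × ThetaIdx γ δ, wnorm (embSeminorm σ') (B.HK c' J') := by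
    refine le_trans ?_ (single_le_sum (f := fun σ' : B.K →+* ℂ => ∑ c' : γ → Bool,
      ∑ J' : Option β × ThetaIdx γ δ, wnorm (embSeminorm σ') (B.HK c' J'))
      (fun _ _ => Finset.sum_nonneg fun _ _ => Finset.sum_nonneg fun _ _ => wnorm_nonneg _ _) (mem_univ σ))
    refine le_trans ?_ (single_le_sum (f := fun c' : γ → Bool =>
      ∑ J' : Option β × ThetaIdx γ δ, wnorm (embSeminorm σ) (B.HK c' J'))
      (fun _ _ => Finset.sum_nonneg fun _ _ => wnorm_nonneg _ _) (mem_univ c))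
    exact single_le_sum (f := fun J' => wnorm (embSeminorm σ) (B.HK c J')) (fun _ _ => wnorm_nonneg _ _)
      (mem_univ J)
  linarith


/-- **A uniform bound for the degrees of the chart polynomials.** [folklore] -/
def hdeg : ℕ := Finset.univ.sup fun cJ : (γ → Bool) × (Option β × ThetaIdx γ δ) => (B.HK cJ.1 cJ.2).totalDegree


/-- `deg HK c J ≤ hdeg`. [folklore] -/
theorem totalDegree_HK_le (c : γ → Bool) (J : Option β × ThetaIdx γ δ) : (B.HK c J).totalDegree ≤ B.hdeg :=
  Finset.le_sup (f := fun cJ : (γ → Bool) × (Option β × ThetaIdx γ δ) => (B.HK cJ.1 cJ.2).totalDegree)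
    (mem_univ (c, J))


/-- `F_ν = homogMonomial D ν ∘ HK c` over `K`. [folklore] -/
def Fν (c : γ → Bool) (D : ℕ) (ν : β ⊕ (γ ⊕ δ) →₀ ℕ) : MvPolynomial (Gen β γ δ) B.K :=
  bind₁ (B.HK c) (homogMonomialᵣ D ν)


/-- The product formula for `F_ν` (with `μ = ν ∘ affIdx⁻¹`, `|μ| = |ν|`). [folklore] -/
theorem Fν_eq (c : γ → Bool) (D : ℕ) (ν : β ⊕ (γ ⊕ δ) →₀ ℕ) :
    B.Fν c D ν = B.HK c (baseIdx (genericChart (γ := γ))) ^ (D - ν.degree) *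
      ∏ i ∈ (ν.mapDomain affIdx).support, B.HK c i ^ (ν.mapDomain affIdx) i := by
  rw [Fν, homogMonomialᵣ, map_mul, map_pow, bind₁_X_right, bind₁_monomial, C_1, one_mul]


/-- **Bounds for `F_ν`**: for `|ν| ≤ D`, `deg F_ν ≤ D·hdeg`, `‖F_ν‖_σ ≤ hB^D`, `d₁^{2D} F_ν` integral.
[folklore] -/
theorem Fν_bounds (σ : B.K →+* ℂ) (c : γ → Bool) {D : ℕ} {ν : β ⊕ (γ ⊕ δ) →₀ ℕ} (hν : ν.degree ≤ D) :
    (B.Fν c D ν).totalDegree ≤ D * B.hdeg ∧ wnorm (embSeminorm σ) (B.Fν c D ν) ≤ B.hB ^ D ∧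
      IsDenInt B.d₁ (2 * D) (B.Fν c D ν) := by
  set μ := ν.mapDomain (affIdx (β := β) (γ := γ) (δ := δ)) with hμ
  have hμdeg : ∑ i ∈ μ.support, μ i = ν.degree := by
    rw [← degree_eq_sum_support, hμ, degree_mapDomain_affIdx]
  have hsplit : D - ν.degree + ν.degree = D := Nat.sub_add_cancel hν
  have h1 := B.embSeminorm_one_le σ
  have hB1 := B.one_le_hB
  rw [Fν_eq]
  refine ⟨?_, ?_, ?_⟩
  · -- degree
    refine (totalDegree_mul _ _).trans ?_
    have hA : (B.HK c (baseIdx genericChart) ^ (D - ν.degree)).totalDegree ≤ (D - ν.degree) * B.hdeg :=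
      (totalDegree_pow _ _).trans (Nat.mul_le_mul_left _ (B.totalDegree_HK_le _ _))
    have hP : (∏ i ∈ μ.support, B.HK c i ^ μ i).totalDegree ≤ ν.degree * B.hdeg := by
      refine (totalDegree_finsetProd _ _).trans ?_
      rw [← hμdeg, Finset.sum_mul]
      refine Finset.sum_le_sum fun i _ => ?_
      exact (totalDegree_pow _ _).trans (Nat.mul_le_mul_left _ (B.totalDegree_HK_le _ _))
    calc _ ≤ (D - ν.degree) * B.hdeg + ν.degree * B.hdeg := add_le_add hA hP
      _ = D * B.hdeg := by rw [← add_mul, hsplit]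
  · -- size
    refine (wnorm_mul_le _ _ _).trans ?_
    have hA : wnorm (embSeminorm σ) (B.HK c (baseIdx genericChart) ^ (D - ν.degree)) ≤ B.hB ^ (D - ν.degree) :=
      (wnorm_pow_le _ h1 _ _).trans (pow_le_pow_left₀ (wnorm_nonneg _ _) (B.wnorm_HK_le _ _ _) _)
    have hP : wnorm (embSeminorm σ) (∏ i ∈ μ.support, B.HK c i ^ μ i) ≤ B.hB ^ ν.degree := by
      refine (wnorm_prod_le _ h1 _ _).trans ?_
      rw [← hμdeg, ← Finset.prod_pow_eq_pow_sum]
      refine Finset.prod_le_prod (fun i _ => wnorm_nonneg _ _) fun i _ => ?_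
      exact (wnorm_pow_le _ h1 _ _).trans (pow_le_pow_left₀ (wnorm_nonneg _ _) (B.wnorm_HK_le _ _ _) _)
    calc _ ≤ B.hB ^ (D - ν.degree) * B.hB ^ ν.degree :=
          mul_le_mul hA hP (wnorm_nonneg _ _) (pow_nonneg (zero_le_one.trans hB1) _)
      _ = B.hB ^ D := by rw [← pow_add, hsplit]
  · -- denominators
    have hA : IsDenInt B.d₁ ((D - ν.degree) * 2) (B.HK c (baseIdx genericChart) ^ (D - ν.degree)) :=
      (B.isDenInt_HK c _).pow _
    have hP : IsDenInt B.d₁ (∑ i ∈ μ.support, μ i * 2) (∏ i ∈ μ.support, B.HK c i ^ μ i) :=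
      IsDenInt.prod' _ fun i _ => (B.isDenInt_HK c i).pow _
    have := hA.mul hP
    rw [← Finset.sum_mul, hμdeg, ← add_mul, hsplit, mul_comm] at this
    exact this


/-- The adapted chart at `s·v`. [folklore] -/
def cAt (s : ℕ) : γ → Bool := chartChoiceAt B.L B.cls ((s : ℂ) • B.v)


/-- The `K`-derivations of the adapted chart at `s·v` along the directions. [folklore] -/
def DK (s : ℕ) (m : Fin B.dd) : MvPolynomial (Gen β γ δ) B.K →ₗ[B.K] MvPolynomial (Gen β γ δ) B.K :=
  (mkDerivation B.K (B.QK (B.cAt s) m)).toLinearMap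


/-- **The entries of the Siegel system**: `entryVal s ω ν = (W^{(s)}_ω F_ν)(gK s)`.
[cite: BakerWustholz2007, §6.8] -/
def entryVal (s : ℕ) {k : ℕ} (ω : Fin k → Fin B.dd) (D : ℕ) (ν : β ⊕ (γ ⊕ δ) →₀ ℕ) : B.K :=
  MvPolynomial.eval (B.gK s) (PolyODE.wordApp (B.DK s) ω (B.Fν (B.cAt s) D ν))


/-- The working denominator at `s·v`: `d_s = d₁^{s+1}`. [folklore] -/
def dAt (s : ℕ) : ℤ := B.d₁ ^ (s + 1)


/-- `d₁ ∣ d_s`. [folklore] -/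
theorem d₁_dvd_dAt (s : ℕ) : B.d₁ ∣ B.dAt s := dvd_pow_self _ (Nat.succ_ne_zero s)


/-- `d_s · gK s i ∈ 𝓞_K`. [folklore] -/
theorem isIntegral_dAt_mul_gK (s : ℕ) (i : Gen β γ δ) : B.IntZ ((B.dAt s : B.K) * B.gK s i) := by
  have h := B.isIntegral_den_pow_mul_gK s i
  have e : ((B.dAt s : ℤ) : B.K) * B.gK s i = (2 : B.K) ^ (s + 1) * ((B.den : B.K) ^ (s + 1) * B.gK s i) := by
    simp only [dAt, d₁, Int.cast_pow, Int.cast_mul, Int.cast_ofNat]; ring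
  have h2 : B.IntZ ((2 : B.K) ^ (s + 1)) := by
    have := (isIntegral_intCast (B := B.K) 2).pow (s + 1)
    simpa using this
  show IsIntegral ℤ _
  rw [e]
  exact h2.mul h


/-- **Bounds for the entries**: for a word `ω` of length `k` and `|ν| ≤ D`,
`|σ(entryVal)| ≤ (D·hdeg + 2k)^k qB^k hB^D ((s+1)M^{s+1})^{D·hdeg + 2k}` for every embedding `σ`, and
`d_s^{2D + 3k + (D·hdeg + 2k)} · entryVal ∈ 𝓞_K`. [cite: BakerWustholz2007, §6.8] -/
theorem entryVal_bounds (σ : B.K →+* ℂ) (s : ℕ) {k : ℕ} (ω : Fin k → Fin B.dd) {D : ℕ}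
    {ν : β ⊕ (γ ⊕ δ) →₀ ℕ} (hν : ν.degree ≤ D) :
    ‖σ (B.entryVal s ω D ν)‖ ≤ (((D * B.hdeg : ℕ) : ℝ) + 2 * k) ^ k * B.qB ^ k * B.hB ^ D *
        ((s + 1) * B.M ^ (s + 1)) ^ (D * B.hdeg + 2 * k) ∧
      B.IntZ ((B.dAt s : B.K) ^ (2 * D + k * 3 + (D * B.hdeg + 2 * k)) * B.entryVal s ω D ν) := by
  obtain ⟨hdegF, hnormF, hdenF⟩ := B.Fν_bounds σ (B.cAt s) hν
  have hq : ∀ m i, wnorm (embSeminorm σ) (B.QK (B.cAt s) m i) ≤ B.qB := fun m i => B.wnorm_QK_le σ _ m i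
  have hQdeg : ∀ m i, (B.QK (B.cAt s) m i).totalDegree ≤ 2 := fun m i => B.totalDegree_QK_le _ m i
  have hdQ : ∀ m i, IsDenInt (B.dAt s) 3 (B.QK (B.cAt s) m i) := fun m i =>
    (B.isDenInt_QK _ m i).of_dvd (B.d₁_dvd_dAt s)
  have hdF : IsDenInt (B.dAt s) (2 * D) (B.Fν (B.cAt s) D ν) := hdenF.of_dvd (B.d₁_dvd_dAt s)
  have hM1 : 1 ≤ (s + 1 : ℝ) * B.M ^ (s + 1) := by
    have hM := B.gens.one_le_M
    have h1 : (1 : ℝ) ≤ s + 1 := by have : (0:ℝ) ≤ s := Nat.cast_nonneg s; linarith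
    exact one_le_mul_of_one_le_of_one_le h1 (one_le_pow₀ hM)
  have hg : ∀ i, ‖σ (B.gK s i)‖ ≤ (s + 1) * B.M ^ (s + 1) := fun i => B.norm_embedding_gK_le σ s i
  have key := ArithPoly.word_eval_bounds σ B.qB_nonneg hq hQdeg hdQ hdegF hnormF hdF
    (fun i => B.isIntegral_dAt_mul_gK s i) hM1 hg ω
  exact key


/-- The equations: `(s, k, α)` with `s ≤ S₀`, `k < T`, `α : Fin dd → Fin T` a content. [folklore] -/
abbrev EIdx (T S₀ : ℕ) : Type := Fin (S₀ + 1) × Fin T × (Fin B.dd → Fin T)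


/-- The words of length `k` and content `α`. [folklore] -/
def wordsOf (k : ℕ) {T : ℕ} (α : Fin B.dd → Fin T) : Finset (Fin k → Fin B.dd) :=
  Finset.univ.filter fun ω => ∀ m, PolyODE.content ω m = (α m : ℕ)


/-- The row sums `∑_{ω of content α} entryVal s ω D ν`. [folklore] -/
def rowSum (D s k : ℕ) {T : ℕ} (α : Fin B.dd → Fin T) (ν : (β ⊕ (γ ⊕ δ)) →₀ ℕ) : B.K :=
  ∑ ω ∈ B.wordsOf k α, B.entryVal s ω D ν


/-- The exponent of the denominator clearing row `(s, k)`. [folklore] -/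
def expE (D k : ℕ) : ℕ := 2 * D + k * 3 + (D * B.hdeg + 2 * k)


/-- `d_s^E · rowSum ∈ 𝓞_K`. [folklore] -/
theorem isIntegral_rowSum (D s k : ℕ) {T : ℕ} (α : Fin B.dd → Fin T) {ν : (β ⊕ (γ ⊕ δ)) →₀ ℕ}
    (hν : ν.degree ≤ D) : B.IntZ ((B.dAt s : B.K) ^ B.expE D k * B.rowSum D s k α ν) := by
  show IsIntegral ℤ _
  rw [rowSum, Finset.mul_sum]
  refine IsIntegral.sum _ fun ω _ => ?_
  exact (B.entryVal_bounds B.emb s ω hν).2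


/-- `d_s ≠ 0` in `K`. [folklore] -/
theorem dAt_ne_zero (s : ℕ) : (B.dAt s : B.K) ≠ 0 := by
  have hden : (B.den : ℤ) ≠ 0 := B.gens.den_ne_zero
  have : (B.dAt s : ℤ) ≠ 0 := by
    simp only [dAt, d₁]
    exact pow_ne_zero _ (mul_ne_zero two_ne_zero hden)
  exact_mod_cast this


/-- **The matrix of the Siegel system** (entries in `𝓞 K`). [cite: BakerWustholz2007, §6.8 (p. 118)] -/
def sMat (D' T S₀ : ℕ) : Matrix (B.EIdx T S₀) (UIdx β γ δ D') (𝓞 B.K) := fun r u =>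
  ⟨(B.dAt r.1 : B.K) ^ B.expE (Fintype.card (β ⊕ (γ ⊕ δ)) * D') r.2.1 *
      B.rowSum (Fintype.card (β ⊕ (γ ⊕ δ)) * D') r.1 r.2.1 r.2.2 (νOf u),
    B.isIntegral_rowSum _ _ _ _ (degree_νOf_le u)⟩


/-- The value of an entry in `K`. [folklore] -/
@[simp] theorem coe_sMat (D' T S₀ : ℕ) (r : B.EIdx T S₀) (u : UIdx β γ δ D') :
    ((B.sMat D' T S₀ r u : 𝓞 B.K) : B.K) =
      (B.dAt r.1 : B.K) ^ B.expE (Fintype.card (β ⊕ (γ ⊕ δ)) * D') r.2.1 *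
        B.rowSum (Fintype.card (β ⊕ (γ ⊕ δ)) * D') r.1 r.2.1 r.2.2 (νOf u) := rfl


variable [DecidableEq β] [DecidableEq δ]

/-- **A solution of the Siegel system kills the row sums**: if `sMat ξ = 0` then for every row
`∑_u ξ_u · rowSum_u = 0` in `K`. [folklore] -/
theorem rowSum_eq_zero_of_mulVec {D' T S₀ : ℕ} {ξ : UIdx β γ δ D' → 𝓞 B.K}
    (h : (B.sMat D' T S₀).mulVec ξ = 0) (r : B.EIdx T S₀) :
    ∑ u, (ξ u : B.K) * B.rowSum (Fintype.card (β ⊕ (γ ⊕ δ)) * D') r.1 r.2.1 r.2.2 (νOf u) = 0 := by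
  have hr := congrFun h r
  simp only [Matrix.mulVec, dotProduct, Pi.zero_apply] at hr
  have hr' := congrArg (algebraMap (𝓞 B.K) B.K) hr
  rw [map_sum, map_zero] at hr'
  simp only [map_mul] at hr'
  have e : ∑ u, algebraMap (𝓞 B.K) B.K (B.sMat D' T S₀ r u) * algebraMap (𝓞 B.K) B.K (ξ u) =
      (B.dAt r.1 : B.K) ^ B.expE (Fintype.card (β ⊕ (γ ⊕ δ)) * D') r.2.1 *
        ∑ u, (ξ u : B.K) * B.rowSum (Fintype.card (β ⊕ (γ ⊕ δ)) * D') r.1 r.2.1 r.2.2 (νOf u) := by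
    rw [Finset.mul_sum]
    refine Finset.sum_congr rfl fun u _ => ?_
    rw [show algebraMap (𝓞 B.K) B.K (B.sMat D' T S₀ r u) = ((B.sMat D' T S₀ r u : 𝓞 B.K) : B.K) from rfl,
      coe_sMat]
    rw [show algebraMap (𝓞 B.K) B.K (ξ u) = ((ξ u : 𝓞 B.K) : B.K) from rfl]
    ring
  rw [e] at hr'
  exact (mul_eq_zero.mp hr').resolve_left (pow_ne_zero _ (B.dAt_ne_zero _))


omit [DecidableEq β] [DecidableEq δ] in
/-- `|d₁| ≥ 1` (indeed `≥ 2`). [folklore] -/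
theorem one_le_abs_d₁ : (1 : ℝ) ≤ |(B.d₁ : ℝ)| := by
  have h := B.gens.one_le_abs_den
  have e : (B.d₁ : ℝ) = 2 * (B.den : ℝ) := by simp [d₁]
  rw [e, abs_mul, abs_two]
  nlinarith [abs_nonneg (B.den : ℝ)]


omit [DecidableEq β] [DecidableEq δ] in
/-- `expE` is monotone in `k`. [folklore] -/
theorem expE_mono (D : ℕ) {k k' : ℕ} (h : k ≤ k') : B.expE D k ≤ B.expE D k' := by
  unfold expE; omega


/-- **The uniform house bound** of the Siegel matrix (explicit in `D = nD'`, `T`, `S₀`).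
[cite: BakerWustholz2007, §6.8 (p. 118: "algebraic integers with sizes at most …")] -/
def houseBound (D' T S₀ : ℕ) : ℝ :=
  (|(B.d₁ : ℝ)|) ^ ((S₀ + 1) * B.expE (Fintype.card (β ⊕ (γ ⊕ δ)) * D') T) * ((B.dd : ℝ) + 1) ^ T *
    (((Fintype.card (β ⊕ (γ ⊕ δ)) * D' * B.hdeg : ℕ) : ℝ) + 2 * T + 1) ^ T * (max 1 B.qB) ^ T *
    B.hB ^ (Fintype.card (β ⊕ (γ ⊕ δ)) * D') *
    ((S₀ + 1) * B.M ^ (S₀ + 1)) ^ (Fintype.card (β ⊕ (γ ⊕ δ)) * D' * B.hdeg + 2 * T)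


omit [DecidableEq β] [DecidableEq δ] in
/-- `1 ≤ (S₀+1) M^{S₀+1}`. [folklore] -/
theorem one_le_MS (S₀ : ℕ) : (1 : ℝ) ≤ (S₀ + 1) * B.M ^ (S₀ + 1) := by
  have hM := B.gens.one_le_M
  have h1 : (1 : ℝ) ≤ S₀ + 1 := by have : (0:ℝ) ≤ S₀ := Nat.cast_nonneg S₀; linarith
  exact one_le_mul_of_one_le_of_one_le h1 (one_le_pow₀ hM)


omit [DecidableEq β] [DecidableEq δ] in
/-- `1 ≤ houseBound`. [folklore] -/
theorem one_le_houseBound (D' T S₀ : ℕ) : 1 ≤ B.houseBound D' T S₀ := by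
  unfold houseBound
  have h1 := B.one_le_abs_d₁
  have h2 : (1 : ℝ) ≤ (B.dd : ℝ) + 1 := by have : (0:ℝ) ≤ B.dd := Nat.cast_nonneg _; linarith
  have h3 : (1 : ℝ) ≤ (((Fintype.card (β ⊕ (γ ⊕ δ)) * D' * B.hdeg : ℕ) : ℝ) + 2 * T + 1) := by
    have : (0:ℝ) ≤ ((Fintype.card (β ⊕ (γ ⊕ δ)) * D' * B.hdeg : ℕ) : ℝ) := Nat.cast_nonneg _
    have : (0:ℝ) ≤ T := Nat.cast_nonneg _
    linarith
  have h4 : (1 : ℝ) ≤ max 1 B.qB := le_max_left _ _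
  have h5 := B.one_le_hB
  have h6 := B.one_le_MS S₀
  have hAB := one_le_mul_of_one_le_of_one_le (one_le_pow₀ (n := (S₀ + 1) * B.expE (Fintype.card (β ⊕ (γ ⊕ δ)) * D') T) h1)
    (one_le_pow₀ (n := T) h2)
  have hABC := one_le_mul_of_one_le_of_one_le hAB (one_le_pow₀ (n := T) h3)
  have h4' := one_le_mul_of_one_le_of_one_le hABC (one_le_pow₀ (n := T) h4)
  have h5' := one_le_mul_of_one_le_of_one_le h4' (one_le_pow₀ (n := Fintype.card (β ⊕ (γ ⊕ δ)) * D') h5)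
  exact one_le_mul_of_one_le_of_one_le h5' (one_le_pow₀ h6)


omit [DecidableEq β] [DecidableEq δ] in
/-- The number of words of content `α` and length `k` is at most `(dd+1)^T` for `k ≤ T`. [folklore] -/
theorem card_wordsOf_le (k : ℕ) {T : ℕ} (hk : k ≤ T) (α : Fin B.dd → Fin T) :
    ((B.wordsOf k α).card : ℝ) ≤ ((B.dd : ℝ) + 1) ^ T := by
  have h1 : (B.wordsOf k α).card ≤ B.dd ^ k := by
    refine (Finset.card_filter_le _ _).trans ?_
    simp [Finset.card_univ]
  have h2 : ((B.dd : ℝ)) ^ k ≤ ((B.dd : ℝ) + 1) ^ k :=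
    pow_le_pow_left₀ (Nat.cast_nonneg _) (by linarith) k
  have h3 : ((B.dd : ℝ) + 1) ^ k ≤ ((B.dd : ℝ) + 1) ^ T :=
    pow_le_pow_right₀ (by have : (0:ℝ) ≤ B.dd := Nat.cast_nonneg _; linarith) hk
  calc ((B.wordsOf k α).card : ℝ) ≤ ((B.dd ^ k : ℕ) : ℝ) := by exact_mod_cast h1
    _ = (B.dd : ℝ) ^ k := by push_cast; ring
    _ ≤ ((B.dd : ℝ) + 1) ^ T := h2.trans h3


omit [DecidableEq β] [DecidableEq δ] in
/-- **Every entry of the Siegel matrix has house `≤ houseBound`.**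
[cite: BakerWustholz2007, §6.8 (p. 118)] -/
theorem house_sMat_le (D' T S₀ : ℕ) (r : B.EIdx T S₀) (u : UIdx β γ δ D') :
    house ((B.sMat D' T S₀ r u : 𝓞 B.K) : B.K) ≤ B.houseBound D' T S₀ := by
  obtain ⟨⟨s, hs⟩, ⟨k, hk⟩, α⟩ := r
  set n := Fintype.card (β ⊕ (γ ⊕ δ)) with hn
  set D := n * D' with hD
  have hsS : s ≤ S₀ := Nat.lt_succ_iff.mp hs
  have hkT : k ≤ T := hk.le
  have hν : (νOf u).degree ≤ D := degree_νOf_le u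
  -- constants
  have hd1 := B.one_le_abs_d₁
  have hMs1 : (1 : ℝ) ≤ (s + 1) * B.M ^ (s + 1) := B.one_le_MS s
  have hMS := B.one_le_MS S₀
  have hhB := B.one_le_hB
  have hq1 : (1 : ℝ) ≤ max 1 B.qB := le_max_left _ _
  have hN1 : (1 : ℝ) ≤ (((D * B.hdeg : ℕ) : ℝ) + 2 * T + 1) := by
    have : (0:ℝ) ≤ ((D * B.hdeg : ℕ) : ℝ) := Nat.cast_nonneg _
    have : (0:ℝ) ≤ T := Nat.cast_nonneg _
    linarith
  -- the bound for one entry value, made uniform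
  have hentry : ∀ (σ : B.K →+* ℂ) (ω : Fin k → Fin B.dd),
      ‖σ (B.entryVal s ω D (νOf u))‖ ≤ (((D * B.hdeg : ℕ) : ℝ) + 2 * T + 1) ^ T * (max 1 B.qB) ^ T *
        B.hB ^ D * ((S₀ + 1) * B.M ^ (S₀ + 1)) ^ (D * B.hdeg + 2 * T) := by
    intro σ ω
    refine (B.entryVal_bounds σ s ω hν).1.trans ?_
    have e1 : (((D * B.hdeg : ℕ) : ℝ) + 2 * k) ^ k ≤ (((D * B.hdeg : ℕ) : ℝ) + 2 * T + 1) ^ T := by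
      refine (pow_le_pow_left₀ (by positivity) ?_ k).trans (pow_le_pow_right₀ hN1 hkT)
      have : (k : ℝ) ≤ T := by exact_mod_cast hkT
      linarith
    have e2 : B.qB ^ k ≤ (max 1 B.qB) ^ T :=
      (pow_le_pow_left₀ B.qB_nonneg (le_max_right _ _) k).trans (pow_le_pow_right₀ hq1 hkT)
    have e3 : ((s + 1 : ℝ) * B.M ^ (s + 1)) ^ (D * B.hdeg + 2 * k) ≤
        ((S₀ + 1 : ℝ) * B.M ^ (S₀ + 1)) ^ (D * B.hdeg + 2 * T) := by
      have hbase : (s + 1 : ℝ) * B.M ^ (s + 1) ≤ (S₀ + 1) * B.M ^ (S₀ + 1) := by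
        have hM := B.gens.one_le_M
        have : (s : ℝ) ≤ S₀ := by exact_mod_cast hsS
        exact mul_le_mul (by linarith) (pow_le_pow_right₀ hM (by omega)) (by positivity) (by positivity)
      exact (pow_le_pow_left₀ (by positivity) hbase _).trans (pow_le_pow_right₀ hMS (by omega))
    have hB0 : 0 ≤ B.hB ^ D := pow_nonneg (zero_le_one.trans hhB) _
    exact mul_le_mul (mul_le_mul (mul_le_mul e1 e2 (pow_nonneg B.qB_nonneg _) (by positivity)) le_rfl hB0
      (by positivity)) e3 (by positivity) (by positivity)
  -- assemble
  refine B.gens.house_le_of_forall_norm_le (zero_le_one.trans (B.one_le_houseBound D' T S₀)) fun σ => ?_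
  rw [coe_sMat]
  simp only
  rw [map_mul, map_pow, norm_mul, norm_pow]
  have hdcast : ‖σ ((B.dAt s : ℤ) : B.K)‖ = (|(B.d₁ : ℝ)|) ^ (s + 1) := by
    rw [map_intCast, Complex.norm_intCast, dAt]
    push_cast
    rw [abs_pow]
  rw [hdcast, ← pow_mul]
  have hrow : ‖σ (B.rowSum D s k α (νOf u))‖ ≤ ((B.dd : ℝ) + 1) ^ T *
      ((((D * B.hdeg : ℕ) : ℝ) + 2 * T + 1) ^ T * (max 1 B.qB) ^ T * B.hB ^ D *
        ((S₀ + 1) * B.M ^ (S₀ + 1)) ^ (D * B.hdeg + 2 * T)) := by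
    rw [rowSum, map_sum]
    refine (norm_sum_le _ _).trans ?_
    refine (Finset.sum_le_sum fun ω _ => hentry σ ω).trans ?_
    rw [Finset.sum_const, nsmul_eq_mul]
    refine mul_le_mul_of_nonneg_right (B.card_wordsOf_le k hkT α) ?_
    have := B.one_le_MS S₀
    positivity
  have hdpow : (|(B.d₁ : ℝ)|) ^ ((s + 1) * B.expE D k) ≤ (|(B.d₁ : ℝ)|) ^ ((S₀ + 1) * B.expE D T) :=
    pow_le_pow_right₀ hd1 (Nat.mul_le_mul (by omega) (B.expE_mono D hkT))
  unfold houseBound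
  rw [← hn, ← hD]
  refine (mul_le_mul hdpow hrow (norm_nonneg _) (by positivity)).trans (le_of_eq ?_)
  push_cast
  ring


/-- The polynomial `Q = ∑_u ξ_u X^{νOf u}` attached to a vector of coefficients. [folklore] -/
def QOf {D' : ℕ} (ξ : UIdx β γ δ D' → 𝓞 B.K) : MvPolynomial (β ⊕ (γ ⊕ δ)) ℂ :=
  ∑ u, monomial (νOf u) (B.emb (ξ u : B.K))


omit [DecidableEq γ] [DecidableEq β] [DecidableEq δ] [Fintype β] [Fintype δ] in
omit [Fintype 𝓙] [DecidableEq 𝓙] in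
/-- Sums of word forms. [folklore] -/
theorem wordForm_sum {L : 𝓙 → PeriodPair} {cls : γ → 𝓙} {κM : δ → γ → Kbar} {d : ℕ} (c : γ → Bool)
    (xs : Fin d → β ⊕ (γ ⊕ δ) → ℂ) (w : β ⊕ (γ ⊕ δ) → ℂ) {k : ℕ} (ω : Fin k → Fin d) {α : Type*}
    (s : Finset α) (P : α → MvPolynomial (Option β × ThetaIdx γ δ) ℂ) [DecidableEq γ] :
    wordForm L cls κM c xs w ω (∑ a ∈ s, P a) = ∑ a ∈ s, wordForm L cls κM c xs w ω (P a) := by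
  classical
  induction s using Finset.induction_on with
  | empty => simp [wordForm]
  | insert a s ha ih => rw [Finset.sum_insert ha, Finset.sum_insert ha, wordForm_add, ih]


/-- `coeff (νOf u) (QOf ξ) = ξ_u`. [folklore] -/
theorem coeff_QOf {D' : ℕ} (ξ : UIdx β γ δ D' → 𝓞 B.K) (u : UIdx β γ δ D') :
    coeff (νOf u) (B.QOf ξ) = B.emb (ξ u : B.K) := by
  rw [QOf, coeff_sum]
  simp only [coeff_monomial]
  rw [Finset.sum_eq_single u]
  · simp
  · intro u' _ hu'
    rw [if_neg]
    exact fun h => hu' (νOf_injective h)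
  · intro h; exact absurd (Finset.mem_univ u) h


/-- `QOf ξ ≠ 0` for `ξ ≠ 0`. [folklore] -/
theorem QOf_ne_zero {D' : ℕ} {ξ : UIdx β γ δ D' → 𝓞 B.K} (hξ : ξ ≠ 0) : B.QOf ξ ≠ 0 := by
  obtain ⟨u, hu⟩ := Function.ne_iff.mp hξ
  intro h
  have hc := B.coeff_QOf ξ u
  rw [h, coeff_zero] at hc
  have h1 : (ξ u : B.K) = 0 := by
    have : B.emb (ξ u : B.K) = 0 := hc.symm
    exact (map_eq_zero_iff B.emb (algebraMap B.K ℂ).injective).mp this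
  exact hu (RingOfIntegers.coe_eq_zero_iff.mp h1)


/-- `deg QOf ≤ n·D'`. [folklore] -/
theorem totalDegree_QOf_le {D' : ℕ} (ξ : UIdx β γ δ D' → 𝓞 B.K) :
    (B.QOf ξ).totalDegree ≤ Fintype.card (β ⊕ (γ ⊕ δ)) * D' := by
  rw [QOf]
  refine (totalDegree_finsetSum _ _).trans (Finset.sup_le fun u _ => ?_)
  refine (totalDegree_monomial_le _ _).trans ?_
  have h := degree_νOf_le u
  rw [Finsupp.degree] at h
  exact h


/-- `homog D (QOf ξ) = ∑_u ξ_u · homogMonomial D (νOf u)` (`D = nD'`). [folklore] -/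
theorem homog_QOf {D' : ℕ} (ξ : UIdx β γ δ D' → 𝓞 B.K) :
    homog (Fintype.card (β ⊕ (γ ⊕ δ)) * D') (B.QOf ξ) =
      ∑ u, C (B.emb (ξ u : B.K)) * homogMonomialᵣ (Fintype.card (β ⊕ (γ ⊕ δ)) * D') (νOf u) := by
  rw [QOf, homog_sum]
  exact Finset.sum_congr rfl fun u _ => homog_monomial (degree_νOf_le u) _


omit [DecidableEq β] [DecidableEq δ] in
/-- **The word forms of a homogenised monomial are the entries** (base change):
`Λ_ω(homogMonomial D ν)` at `s·v` in the chart `c_s` is `emb (entryVal s ω D ν)`. [folklore] -/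
theorem wordForm_homogMonomial (s D : ℕ) {k : ℕ} (ω : Fin k → Fin B.dd) (ν : (β ⊕ (γ ⊕ δ)) →₀ ℕ) :
    wordForm B.L B.cls B.κM (B.cAt s) B.xs ((s : ℂ) • B.v) ω (homogMonomialᵣ D ν) = B.emb (B.entryVal s ω D ν) := by
  have h := wordForm_eq_map (β := β) B.L B.cls B.κM B.emb (g2 := B.g2K) (g3 := B.g3K)
    (fun _ => rfl) (fun _ => rfl) (κ := B.κK)
    (fun _ _ => rfl) (B.cAt s) (xs := B.xs) (xK := B.xK) (fun _ _ => rfl) (w := (s : ℂ) • B.v)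
    (gK := B.gK s) (fun i => B.emb_gK s 0 i) (P := homogMonomialᵣ D ν) (PK := homogMonomialᵣ D ν)
    (map_homogMonomialᵣ _ _ _) ω
  rw [h]
  rfl


/-- **The Siegel system encodes the vanishing conditions**: if `sMat ξ = 0` then `F_{homog D (QOf ξ)}`
vanishes to order `≥ T` along `𝔟 = ⟨x_m⟩` at `s·v` for every `s ≤ S₀`.
[cite: BakerWustholz2007, §6.8 (p. 118)] -/
theorem vanishesAlong_of_mulVec {D' T S₀ : ℕ} {ξ : UIdx β γ δ D' → 𝓞 B.K}
    (h : (B.sMat D' T S₀).mulVec ξ = 0) {s : ℕ} (hs : s ≤ S₀) :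
    VanishesAlong (Submodule.span ℂ (Set.range B.xs))
      (thetaEval B.L B.cls B.κM (homog (Fintype.card (β ⊕ (γ ⊕ δ)) * D') (B.QOf ξ))) ((s : ℂ) • B.v) T := by
  set D := Fintype.card (β ⊕ (γ ⊕ δ)) * D' with hD
  refine vanishesAlong_span_of_wordForms B.L B.cls B.κM (isHomogeneous_homog D _) (B.cAt s)
    (fun x => zero_mem_chartDomain_chartChoiceAt B.L B.cls _ x) B.xs T fun k hk α => ?_
  -- the row of the system
  let α' : Fin B.dd → Fin T := fun m => ⟨α m, lt_of_lt_of_le (α m).isLt (Nat.succ_le_of_lt hk)⟩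
  have hrow := B.rowSum_eq_zero_of_mulVec h (⟨s, Nat.lt_succ_of_le hs⟩, ⟨k, hk⟩, α')
  simp only at hrow
  -- expand the word forms of `P = ∑_u ξ_u homogMonomial_u`
  have hP : ∀ ω : Fin k → Fin B.dd, wordForm B.L B.cls B.κM (B.cAt s) B.xs ((s : ℂ) • B.v) ω (homog D (B.QOf ξ)) =
      B.emb (∑ u, (ξ u : B.K) * B.entryVal s ω D (νOf u)) := by
    intro ω
    rw [homog_QOf, wordForm_sum, map_sum]
    refine Finset.sum_congr rfl fun u _ => ?_
    rw [← smul_eq_C_mul, wordForm_smul, wordForm_homogMonomial, map_mul]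
  have hset : Finset.univ.filter (fun ω : Fin k → Fin B.dd => ∀ m, PolyODE.content ω m = α m) =
      B.wordsOf k α' := by
    ext ω; simp [wordsOf, α']
  rw [Finset.sum_congr rfl fun ω _ => hP ω, ← map_sum, hset]
  rw [show ∑ ω ∈ B.wordsOf k α', ∑ u, (ξ u : B.K) * B.entryVal s ω D (νOf u) =
      ∑ u, (ξ u : B.K) * B.rowSum D s k α' (νOf u) from by
    rw [Finset.sum_comm]
    refine Finset.sum_congr rfl fun u _ => ?_
    rw [rowSum, Finset.mul_sum]]
  rw [hrow, map_zero]


omit [DecidableEq β] [DecidableEq δ] in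
/-- Cardinality of the equations. [folklore] -/
theorem card_EIdx (T S₀ : ℕ) : Fintype.card (B.EIdx T S₀) = (S₀ + 1) * (T * T ^ B.dd) := by
  simp [EIdx]


/-- **The auxiliary function of Baker's method on `M_κ`.** For `T ≥ 1` and parameters with
`(S₀+1)·T·T^{dd} < (D'+1)^n` there is a non-zero vector `ξ ∈ 𝓞 K^{unknowns}` of house
`≤ C_K (C_K q A)^{p/(q-p)}` (`A = houseBound`, `p, q` the two cardinalities) such that the form
`P = homog (nD') (QOf ξ)` satisfies: `F_P ≢ 0`, and `F_P` vanishes to order `≥ T` along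
`𝔟 = ⟨x_1, …, x_dd⟩` at all points `s·v`, `s ≤ S₀`. [cite: BakerWustholz2007, §6.8 (pp. 118–119)] -/
theorem exists_auxiliary (D' T S₀ : ℕ) (hT : 0 < T)
    (hpq : (S₀ + 1) * (T * T ^ B.dd) < (D' + 1) ^ Fintype.card (β ⊕ (γ ⊕ δ))) :
    ∃ ξ : UIdx β γ δ D' → 𝓞 B.K, ξ ≠ 0 ∧
      (∀ u, house ((ξ u : 𝓞 B.K) : B.K) ≤ siegelConst B.K *
        (siegelConst B.K * ((D' + 1) ^ Fintype.card (β ⊕ (γ ⊕ δ)) : ℕ) * B.houseBound D' T S₀) ^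
          ((((S₀ + 1) * (T * T ^ B.dd) : ℕ) : ℝ) /
            ((((D' + 1) ^ Fintype.card (β ⊕ (γ ⊕ δ)) : ℕ) : ℝ) - ((S₀ + 1) * (T * T ^ B.dd) : ℕ)))) ∧
      (∃ w, thetaEval B.L B.cls B.κM (homog (Fintype.card (β ⊕ (γ ⊕ δ)) * D') (B.QOf ξ)) w ≠ 0) ∧
      ∀ s ≤ S₀, VanishesAlong (Submodule.span ℂ (Set.range B.xs))
        (thetaEval B.L B.cls B.κM (homog (Fintype.card (β ⊕ (γ ⊕ δ)) * D') (B.QOf ξ))) ((s : ℂ) • B.v) T := by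
  have h0p : 0 < (S₀ + 1) * (T * T ^ B.dd) := Nat.mul_pos (Nat.succ_pos _) (Nat.mul_pos hT (pow_pos hT _))
  obtain ⟨ξ, hξ, hmul, hhouse⟩ := siegel_house B.K (B.sMat D' T S₀) h0p hpq (B.card_EIdx T S₀) (card_UIdx D')
    (B.one_le_houseBound D' T S₀) (fun r u => B.house_sMat_le D' T S₀ r u)
  refine ⟨ξ, hξ, fun u => hhouse u, ?_, fun s hs => B.vanishesAlong_of_mulVec hmul hs⟩
  exact exists_thetaEval_homog_ne_zero B.L B.cls B.κM (B.QOf_ne_zero hξ) (B.totalDegree_QOf_le ξ)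


end BakerData

end Siegel

/-! ### Values on the line: jets of the auxiliary function at the points -/

section LineVals

open Finset NumberField

omit [Fintype 𝓙] [DecidableEq 𝓙] in
/-- **The first non-vanishing line jet.** For a form `P` of degree `D`, a chart choice `c` valid
at `w` and a direction `x`: if the line jets of `F_P` at `w` along `x` of orders `< k` vanish, then
`d^k/dξ^k F_P(w + ξx)|₀ = Θ_{J₀}(w)^D · ((D_x)^k (P ∘ H̃))(gens(w))`.
[cite: BakerWustholz2007, §6.8 (p. 119: Ψ(s) = ϱ^δ ξ)] -/
theorem iteratedDeriv_thetaEval_line_eq {P : MvPolynomial (Option β × ThetaIdx γ δ) ℂ} {D : ℕ}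
    (hP : P.IsHomogeneous D) (c : γ → Bool) {w : β ⊕ (γ ⊕ δ) → ℂ} (x : β ⊕ (γ ⊕ δ) → ℂ)
    (hc : (0 : ℂ) ∈ chartDomain L cls c w x) {k : ℕ}
    (hlow : ∀ i < k, iteratedDeriv i (fun ξ : ℂ => thetaEval L cls κM P (w + ξ • x)) 0 = 0) :
    iteratedDeriv k (fun ξ : ℂ => thetaEval L cls κM P (w + ξ • x)) 0 =
      theta L cls κM (baseIdx c) w ^ D *
        MvPolynomial.eval (genFun L cls κM c w x 0)
          ((PolyODE.der (genODE L cls κM c x))^[k] (MvPolynomial.bind₁ (HPoly L cls κM c) P)) := by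
  -- `Θ_{J₀}(w) ≠ 0`
  have h0 : theta L cls κM (baseIdx c) w ≠ 0 := by
    rw [theta_baseIdx]
    refine Finset.prod_ne_zero_iff.mpr fun b _ => ?_
    have hv := hc b
    simp only [zero_mul, add_zero] at hv
    exact (factor_blocks (c b) hv 0).1
  -- the factorisation near `0`
  set g : ℂ → ℂ := fun ξ => theta L cls κM (baseIdx c) (w + ξ • x) ^ D with hg
  set E : ℂ → ℂ := fun ξ => MvPolynomial.eval (genFun L cls κM c w x ξ) (MvPolynomial.bind₁ (HPoly L cls κM c) P)
    with hE
  have hgan : AnalyticAt ℂ g 0 := (analyticAt_theta_line L cls κM (baseIdx c) w x 0).pow D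
  have hg0 : g 0 = theta L cls κM (baseIdx c) w ^ D := by simp [hg]
  have hopen := isOpen_chartDomain L cls c w x
  have hev : ∀ᶠ ξ in 𝓝 (0 : ℂ), ξ ∈ chartDomain L cls c w x := hopen.mem_nhds hc
  have hnear : ∀ᶠ ξ in 𝓝 (0 : ℂ), theta L cls κM (baseIdx c) (w + ξ • x) ≠ 0 := by
    have h0' : theta L cls κM (baseIdx c) (w + (0 : ℂ) • x) ≠ 0 := by simpa using h0
    exact (analyticAt_theta_line L cls κM (baseIdx c) w x 0).continuousAt.eventually_ne h0'
  have hEeq : (fun ξ : ℂ => MvPolynomial.eval (fun J => chartCoord L cls κM (baseIdx c) J (w + ξ • x)) P)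
      =ᶠ[𝓝 0] E := by
    filter_upwards [hev] with ξ hξ
    have hb : MvPolynomial.eval (genFun L cls κM c w x ξ) (MvPolynomial.bind₁ (HPoly L cls κM c) P) =
        MvPolynomial.eval (fun J => MvPolynomial.eval (genFun L cls κM c w x ξ) (HPoly L cls κM c J)) P :=
      MvPolynomial.eval₂Hom_bind₁ _ _ _ _
    have hfun : (fun J => chartCoord L cls κM (baseIdx c) J (w + ξ • x)) =
        fun J => MvPolynomial.eval (genFun L cls κM c w x ξ) (HPoly L cls κM c J) :=
      funext fun J => chartCoord_baseIdx_eq_eval L cls κM c w x hξ J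
    show _ = MvPolynomial.eval (genFun L cls κM c w x ξ) (MvPolynomial.bind₁ (HPoly L cls κM c) P)
    rw [hb, hfun]
  have hEan : AnalyticAt ℂ E 0 := by
    have h0' : theta L cls κM (baseIdx c) (w + (0 : ℂ) • x) ≠ 0 := by simpa using h0
    exact (analyticAt_eval_chart_line L cls κM P (baseIdx c) w x h0').congr hEeq
  have hfac : (fun ξ : ℂ => thetaEval L cls κM P (w + ξ • x)) =ᶠ[𝓝 0] fun ξ => g ξ * E ξ := by
    filter_upwards [hnear, hEeq] with ξ hξ hξE
    rw [thetaEval_eq_pow_mul_eval_chart L cls κM hP (baseIdx c) hξ, ← hξE]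
  -- lower jets of `E` vanish
  have hlowE : ∀ i < k, iteratedDeriv i E 0 = 0 := by
    have hlow' : ∀ i < k, iteratedDeriv i (fun ξ => g ξ * E ξ) 0 = 0 := fun i hi => by
      rw [← hfac.iteratedDeriv_eq i]; exact hlow i hi
    exact (forall_iteratedDeriv_mul_eq_zero_iff hEan hgan (by rw [hg0]; exact pow_ne_zero _ h0) k).mp hlow'
  rw [iteratedDeriv_eq_mul_of_lowerJets_eq_zero hgan hEan hfac hlowE, hg0, hE,
    iteratedDeriv_eval_genFun L cls κM c w x _ k hc]


omit [Fintype 𝓙] [DecidableEq 𝓙] in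
/-- **The first non-vanishing line jet along `x = ∑ c_m x_m`** is
`Θ_{J₀}(w)^D · ∑_ω (∏_t c_{ω t}) · Λ_ω(P)`. [folklore] -/
theorem iteratedDeriv_thetaEval_line_sum_eq {P : MvPolynomial (Option β × ThetaIdx γ δ) ℂ} {D : ℕ}
    (hP : P.IsHomogeneous D) (c : γ → Bool) {w : β ⊕ (γ ⊕ δ) → ℂ}
    (hc : ∀ x : β ⊕ (γ ⊕ δ) → ℂ, (0 : ℂ) ∈ chartDomain L cls c w x) {d : ℕ}
    (xs : Fin d → β ⊕ (γ ⊕ δ) → ℂ) (cs : Fin d → ℂ) {k : ℕ}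
    (hlow : ∀ i < k, iteratedDeriv i (fun ξ : ℂ => thetaEval L cls κM P (w + ξ • ∑ m, cs m • xs m)) 0 = 0) :
    iteratedDeriv k (fun ξ : ℂ => thetaEval L cls κM P (w + ξ • ∑ m, cs m • xs m)) 0 =
      theta L cls κM (baseIdx c) w ^ D *
        ∑ ω : Fin k → Fin d, (∏ t, cs (ω t)) * wordForm L cls κM c xs w ω P := by
  rw [iteratedDeriv_thetaEval_line_eq L cls κM hP c _ (hc _) hlow]
  congr 1
  have hg : genFun L cls κM c w (∑ m, cs m • xs m) 0 = genFun L cls κM c w 0 0 := by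
    funext i; rcases i with j | ⟨b, i⟩ | e <;> simp [genFun]
  rw [hg, der_genODE_sum_smul]
  set Dm : Fin d → MvPolynomial (Gen β γ δ) ℂ →ₗ[ℂ] MvPolynomial (Gen β γ δ) ℂ :=
    fun m => (PolyODE.der (genODE L cls κM c (xs m))).toLinearMap with hDm
  have hfun : (⇑(∑ m, cs m • PolyODE.der (genODE L cls κM c (xs m))) :
      MvPolynomial (Gen β γ δ) ℂ → MvPolynomial (Gen β γ δ) ℂ) = ⇑(∑ m, cs m • Dm m) := by
    rw [Derivation.coe_sum_smul, LinearMap.coe_sum]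
    exact Finset.sum_congr rfl fun m _ => by rw [LinearMap.coe_smul, hDm, Derivation.coeFn_coe]
  rw [hfun, PolyODE.iterate_sum_smul_apply, map_sum]
  refine Finset.sum_congr rfl fun ω _ => ?_
  rw [smul_eq_C_mul, map_mul, MvPolynomial.eval_C]
  rfl


namespace BakerData

variable {L cls κM}
variable [DecidableEq β] [DecidableEq δ] (B : BakerData 𝓙 β γ δ)

/-- The content of a word as a finitely supported function. [folklore] -/
def contentFs {k : ℕ} (ω : Fin k → Fin B.dd) : Fin B.dd →₀ ℕ :=
  Finsupp.equivFunOnFinite.symm (PolyODE.content ω)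


omit [DecidableEq β] [DecidableEq δ] in
/-- `contentFs ω m = content ω m`. [folklore] -/
@[simp] theorem contentFs_apply {k : ℕ} (ω : Fin k → Fin B.dd) (m : Fin B.dd) :
    B.contentFs ω m = PolyODE.content ω m := by
  simp [contentFs]


/-- **The polynomial `p_{s,k} ∈ K[c_1,…,c_dd]`** whose values at grid points are the normalised
line jets: `p_{s,k} = ∑_ω X^{content ω} · ∑_u ξ_u · entryVal s ω D (νOf u)` (`D = nD'`).
[cite: BakerWustholz2007, §6.8 (p. 119)] -/
def lineValPoly {D' : ℕ} (ξ : UIdx β γ δ D' → 𝓞 B.K) (s k : ℕ) : MvPolynomial (Fin B.dd) B.K :=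
  ∑ ω : Fin k → Fin B.dd, monomial (B.contentFs ω)
    (∑ u, (ξ u : B.K) * B.entryVal s ω (Fintype.card (β ⊕ (γ ⊕ δ)) * D') (νOf u))


/-- `deg_{c_m} p_{s,k} ≤ k`. [folklore] -/
theorem degreeOf_lineValPoly_le {D' : ℕ} (ξ : UIdx β γ δ D' → 𝓞 B.K) (s k : ℕ) (m : Fin B.dd) :
    (B.lineValPoly ξ s k).degreeOf m ≤ k := by
  rw [lineValPoly, MvPolynomial.degreeOf_le_iff]
  intro α hα
  obtain ⟨ω, -, hω⟩ := Finset.mem_biUnion.mp (MvPolynomial.support_sum hα)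
  have hsub := MvPolynomial.support_monomial_subset hω
  rw [Finset.mem_singleton] at hsub
  rw [hsub, contentFs_apply]
  exact PolyODE.content_le ω m


/-- The word forms of `P = homog D (QOf ξ)` at `s·v` are `emb(∑_u ξ_u · entryVal s ω D (νOf u))`.
[folklore] -/
theorem wordForm_homog_QOf {D' : ℕ} (ξ : UIdx β γ δ D' → 𝓞 B.K) (s : ℕ) {k : ℕ} (ω : Fin k → Fin B.dd) :
    wordForm B.L B.cls B.κM (B.cAt s) B.xs ((s : ℂ) • B.v) ω
        (homog (Fintype.card (β ⊕ (γ ⊕ δ)) * D') (B.QOf ξ)) =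
      B.emb (∑ u, (ξ u : B.K) * B.entryVal s ω (Fintype.card (β ⊕ (γ ⊕ δ)) * D') (νOf u)) := by
  rw [homog_QOf, wordForm_sum, map_sum]
  refine Finset.sum_congr rfl fun u _ => ?_
  rw [← smul_eq_C_mul, wordForm_smul, wordForm_homogMonomial, map_mul]


/-- **The coefficients of `p_{s,k}` are the content sums of word forms**: for a content
`α : Fin dd → ℕ`, `emb(coeff_α p_{s,k}) = ∑_{ω of content α} Λ_ω(P)` at `s·v`. [folklore] -/
theorem emb_coeff_lineValPoly {D' : ℕ} (ξ : UIdx β γ δ D' → 𝓞 B.K) (s k : ℕ) (α : Fin B.dd → ℕ) :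
    B.emb (coeff (Finsupp.equivFunOnFinite.symm α) (B.lineValPoly ξ s k)) =
      ∑ ω ∈ Finset.univ.filter (fun ω : Fin k → Fin B.dd => ∀ m, PolyODE.content ω m = α m),
        wordForm B.L B.cls B.κM (B.cAt s) B.xs ((s : ℂ) • B.v) ω
          (homog (Fintype.card (β ⊕ (γ ⊕ δ)) * D') (B.QOf ξ)) := by
  rw [lineValPoly, coeff_sum, map_sum, Finset.sum_filter]
  refine Finset.sum_congr rfl fun ω _ => ?_
  rw [coeff_monomial]
  have hiff : (B.contentFs ω = Finsupp.equivFunOnFinite.symm α) ↔ ∀ m, PolyODE.content ω m = α m := by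
    constructor
    · intro h m
      have := congrArg (fun f => f m) h
      simpa [contentFs] using this
    · intro h
      ext m
      simp [contentFs, h m]
  by_cases h : ∀ m, PolyODE.content ω m = α m
  · rw [if_pos (hiff.mpr h), if_pos h, wordForm_homog_QOf]
  · rw [if_neg (fun h' => h (hiff.mp h')), if_neg h, map_zero]


/-- **The normalised line jets at `s·v` along grid directions.** For `c : Fin dd → ℕ` and
`x_c = ∑ c_m x_m`: if the line jets of `F_P` (`P = homog D (QOf ξ)`) at `s·v` along `x_c` of
orders `< k` vanish, then `φ_{x_c,k}(s) = Θ_{J₀(c_s)}(s·v)^D · emb(p_{s,k}(c))`.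
[cite: BakerWustholz2007, §6.8 (p. 119)] -/
theorem iteratedDeriv_grid_eq {D' : ℕ} (ξ : UIdx β γ δ D' → 𝓞 B.K) (s k : ℕ) (cg : Fin B.dd → ℕ)
    (hlow : ∀ i < k, iteratedDeriv i (fun t : ℂ => thetaEval B.L B.cls B.κM
      (homog (Fintype.card (β ⊕ (γ ⊕ δ)) * D') (B.QOf ξ)) ((s : ℂ) • B.v + t • ∑ m, (cg m : ℂ) • B.xs m)) 0 = 0) :
    iteratedDeriv k (fun t : ℂ => thetaEval B.L B.cls B.κM
        (homog (Fintype.card (β ⊕ (γ ⊕ δ)) * D') (B.QOf ξ)) ((s : ℂ) • B.v + t • ∑ m, (cg m : ℂ) • B.xs m)) 0 =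
      theta B.L B.cls B.κM (baseIdx (B.cAt s)) ((s : ℂ) • B.v) ^ (Fintype.card (β ⊕ (γ ⊕ δ)) * D') *
        B.emb (MvPolynomial.eval (fun m => (cg m : B.K)) (B.lineValPoly ξ s k)) := by
  rw [iteratedDeriv_thetaEval_line_sum_eq B.L B.cls B.κM (isHomogeneous_homog _ _) (B.cAt s)
    (fun x => zero_mem_chartDomain_chartChoiceAt B.L B.cls _ x) B.xs (fun m => (cg m : ℂ)) hlow]
  congr 1
  rw [lineValPoly, map_sum, map_sum]
  refine Finset.sum_congr rfl fun ω _ => ?_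
  rw [MvPolynomial.eval_monomial, map_mul, wordForm_homog_QOf, mul_comm (B.emb _)]
  congr 1
  rw [Finsupp.prod_fintype _ _ (fun m => by simp), map_prod]
  simp only [contentFs_apply, map_pow, map_natCast]
  rw [PolyODE.prod_word_eq_prod_pow_content (fun m => (cg m : ℂ))]


/-- **`d_s^{E(D,k)} · p_{s,k}(c) ∈ 𝓞 K`** (`D = nD'`). [folklore] -/
theorem intZ_lineVal {D' : ℕ} (ξ : UIdx β γ δ D' → 𝓞 B.K) (s k : ℕ) (cg : Fin B.dd → ℕ) :
    B.IntZ ((B.dAt s : B.K) ^ B.expE (Fintype.card (β ⊕ (γ ⊕ δ)) * D') k *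
      MvPolynomial.eval (fun m => (cg m : B.K)) (B.lineValPoly ξ s k)) := by
  show IsIntegral ℤ _
  rw [lineValPoly, map_sum, Finset.mul_sum]
  refine IsIntegral.sum _ fun ω _ => ?_
  rw [MvPolynomial.eval_monomial, ← mul_assoc]
  refine IsIntegral.mul ?_ ?_
  · rw [Finset.mul_sum]
    refine IsIntegral.sum _ fun u _ => ?_
    rw [mul_left_comm]
    exact IsIntegral.mul (ξ u).2 (B.entryVal_bounds B.emb s ω (degree_νOf_le u)).2
  · rw [Finsupp.prod_fintype _ _ (fun m => by simp)]
    refine IsIntegral.prod _ fun m _ => IsIntegral.pow ?_ _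
    exact_mod_cast isIntegral_algebraMap (R := ℤ) (A := B.K) (x := (cg m : ℤ))


/-- A common bound for the houses of the coefficients `ξ_u`: `H_ξ = 1 + ∑_u house(ξ_u)`.
[folklore] -/
def houseXi {D' : ℕ} (ξ : UIdx β γ δ D' → 𝓞 B.K) : ℝ := 1 + ∑ u, house ((ξ u : 𝓞 B.K) : B.K)


/-- `1 ≤ H_ξ`. [folklore] -/
theorem one_le_houseXi {D' : ℕ} (ξ : UIdx β γ δ D' → 𝓞 B.K) : 1 ≤ B.houseXi ξ := by
  have : 0 ≤ ∑ u, house ((ξ u : 𝓞 B.K) : B.K) := Finset.sum_nonneg fun u _ => house_nonneg _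
  unfold houseXi; linarith


/-- Every conjugate of every `ξ_u` is at most `H_ξ`. [folklore] -/
theorem norm_embedding_xi_le {D' : ℕ} (ξ : UIdx β γ δ D' → 𝓞 B.K) (σ : B.K →+* ℂ) (u : UIdx β γ δ D') :
    ‖σ ((ξ u : 𝓞 B.K) : B.K)‖ ≤ B.houseXi ξ := by
  refine (norm_embedding_le_house _ σ).trans ?_
  have h1 : house ((ξ u : 𝓞 B.K) : B.K) ≤ ∑ u', house ((ξ u' : 𝓞 B.K) : B.K) :=
    Finset.single_le_sum (f := fun u' => house ((ξ u' : 𝓞 B.K) : B.K)) (fun _ _ => house_nonneg _)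
      (Finset.mem_univ u)
  unfold houseXi; linarith


/-- The bound for the conjugates of `p_{s,k}(c)`. [folklore] -/
def lineValBound {D' : ℕ} (ξ : UIdx β γ δ D' → 𝓞 B.K) (s k : ℕ) : ℝ :=
  (B.dd : ℝ) ^ k * (k : ℝ) ^ k * (Fintype.card (UIdx β γ δ D') : ℝ) * B.houseXi ξ *
    ((((Fintype.card (β ⊕ (γ ⊕ δ)) * D' * B.hdeg : ℕ) : ℝ) + 2 * k) ^ k * B.qB ^ k *
      B.hB ^ (Fintype.card (β ⊕ (γ ⊕ δ)) * D') *
        ((s + 1) * B.M ^ (s + 1)) ^ (Fintype.card (β ⊕ (γ ⊕ δ)) * D' * B.hdeg + 2 * k))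


/-- `0 ≤ lineValBound`. [folklore] -/
theorem lineValBound_nonneg {D' : ℕ} (ξ : UIdx β γ δ D' → 𝓞 B.K) (s k : ℕ) : 0 ≤ B.lineValBound ξ s k := by
  unfold lineValBound
  have := B.one_le_houseXi ξ
  have := B.qB_nonneg
  have := B.one_le_hB
  have := B.gens.one_le_M
  positivity


/-- **All conjugates of `p_{s,k}(c)` are at most `lineValBound`** (for `c_m ≤ k`).
[cite: BakerWustholz2007, §6.8 (p. 119)] -/
theorem norm_embedding_lineVal_le {D' : ℕ} (ξ : UIdx β γ δ D' → 𝓞 B.K) (s k : ℕ) {cg : Fin B.dd → ℕ}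
    (hcg : ∀ m, cg m ≤ k) (σ : B.K →+* ℂ) :
    ‖σ (MvPolynomial.eval (fun m => (cg m : B.K)) (B.lineValPoly ξ s k))‖ ≤ B.lineValBound ξ s k := by
  set n := Fintype.card (β ⊕ (γ ⊕ δ)) with hn
  set D := n * D' with hD
  -- the entry bound
  set Eb : ℝ := ((((D * B.hdeg : ℕ) : ℝ) + 2 * k) ^ k * B.qB ^ k * B.hB ^ D *
    ((s + 1) * B.M ^ (s + 1)) ^ (D * B.hdeg + 2 * k)) with hEb
  have hEb0 : 0 ≤ Eb := by
    have := B.qB_nonneg; have := B.one_le_hB; have := B.gens.one_le_M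
    positivity
  have hHξ := B.one_le_houseXi ξ
  -- one word
  have hword : ∀ ω : Fin k → Fin B.dd,
      ‖σ (MvPolynomial.eval (fun m => (cg m : B.K)) (monomial (B.contentFs ω)
        (∑ u, (ξ u : B.K) * B.entryVal s ω D (νOf u))))‖ ≤
        (k : ℝ) ^ k * ((Fintype.card (UIdx β γ δ D') : ℝ) * (B.houseXi ξ * Eb)) := by
    intro ω
    rw [MvPolynomial.eval_monomial, map_mul, norm_mul, mul_comm]
    refine mul_le_mul ?_ ?_ (norm_nonneg _) (by positivity)
    · -- `∏_m c_m^{content} = ∏_t c_{ω t} ≤ k^k`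
      rw [Finsupp.prod_fintype _ _ (fun m => by simp), map_prod, norm_prod]
      simp only [contentFs_apply, map_pow, map_natCast, norm_pow, Complex.norm_natCast]
      rw [← PolyODE.prod_word_eq_prod_pow_content (fun m => (cg m : ℝ)) ω]
      calc ∏ t, (cg (ω t) : ℝ) ≤ ∏ _t : Fin k, (k : ℝ) :=
            Finset.prod_le_prod (fun t _ => Nat.cast_nonneg _) fun t _ => by exact_mod_cast hcg (ω t)
        _ = (k : ℝ) ^ k := by simp
    · rw [map_sum]
      refine (norm_sum_le _ _).trans ?_
      refine (Finset.sum_le_sum fun u _ => ?_).trans (by rw [Finset.sum_const, nsmul_eq_mul, Finset.card_univ])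
      rw [map_mul, norm_mul]
      exact mul_le_mul (B.norm_embedding_xi_le ξ σ u) (B.entryVal_bounds σ s ω (degree_νOf_le u)).1
        (norm_nonneg _) (zero_le_one.trans hHξ)
  rw [lineValPoly, map_sum, map_sum]
  refine (norm_sum_le _ _).trans ?_
  refine (Finset.sum_le_sum fun ω _ => hword ω).trans ?_
  rw [Finset.sum_const, nsmul_eq_mul, Finset.card_univ, Fintype.card_fun, Fintype.card_fin, Fintype.card_fin]
  unfold lineValBound
  rw [← hn, ← hD, ← hEb]
  push_cast
  have : (0 : ℝ) ≤ (B.dd : ℝ) ^ k := by positivity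
  nlinarith [hEb0, hHξ, this]


/-- **Liouville step.** If `p_{s,k}(c) ≠ 0` then
`1 ≤ |emb(p_{s,k}(c))| · |d_s|^{E} · (|d_s|^{E} · lineValBound)^{h-1}`; contrapositively, a
smaller value forces `p_{s,k}(c) = 0`. [cite: Baker1975, Ch. 2 Lemma 5] -/
theorem one_le_of_lineVal_ne_zero {D' : ℕ} (ξ : UIdx β γ δ D' → 𝓞 B.K) (s k : ℕ) {cg : Fin B.dd → ℕ}
    (hcg : ∀ m, cg m ≤ k) (hne : MvPolynomial.eval (fun m => (cg m : B.K)) (B.lineValPoly ξ s k) ≠ 0) :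
    1 ≤ ‖B.emb (MvPolynomial.eval (fun m => (cg m : B.K)) (B.lineValPoly ξ s k))‖ *
      |(B.dAt s : ℝ)| ^ B.expE (Fintype.card (β ⊕ (γ ⊕ δ)) * D') k *
        (|(B.dAt s : ℝ)| ^ B.expE (Fintype.card (β ⊕ (γ ⊕ δ)) * D') k * B.lineValBound ξ s k) ^ (B.gens.h - 1) := by
  set E := B.expE (Fintype.card (β ⊕ (γ ⊕ δ)) * D') k with hE
  set p := MvPolynomial.eval (fun m => (cg m : B.K)) (B.lineValPoly ξ s k) with hp
  set y : B.K := (B.dAt s : B.K) ^ E * p with hy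
  have hyint : IsIntegral ℤ y := B.intZ_lineVal ξ s k cg
  let x : 𝓞 B.K := ⟨y, hyint⟩
  have hx : x ≠ 0 := by
    intro h
    have : y = 0 := by simpa [x] using congrArg (fun z : 𝓞 B.K => (z : B.K)) h
    rw [hy] at this
    exact hne ((mul_eq_zero.mp this).resolve_left (pow_ne_zero _ (B.dAt_ne_zero s)))
  have hL := B.gens.one_le_norm_mul_house_pow hx
  -- `‖y‖ = |d_s|^E ‖emb p‖`, `house y ≤ |d_s|^E · bound`
  have hnormy : ‖((x : B.K) : ℂ)‖ = |(B.dAt s : ℝ)| ^ E * ‖B.emb p‖ := by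
    show ‖(y : ℂ)‖ = _
    have : (y : ℂ) = B.emb y := rfl
    rw [this, hy, map_mul, map_pow, norm_mul, norm_pow, map_intCast, Complex.norm_intCast]
  have hhouse : house (x : B.K) ≤ |(B.dAt s : ℝ)| ^ E * B.lineValBound ξ s k := by
    refine B.gens.house_le_of_forall_norm_le (by have := B.lineValBound_nonneg ξ s k; positivity) fun σ => ?_
    show ‖σ y‖ ≤ _
    rw [hy, map_mul, map_pow, norm_mul, norm_pow, map_intCast, Complex.norm_intCast]
    exact mul_le_mul_of_nonneg_left (B.norm_embedding_lineVal_le ξ s k hcg σ) (by positivity)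
  calc (1 : ℝ) ≤ ‖((x : B.K) : ℂ)‖ * house (x : B.K) ^ (B.gens.h - 1) := hL
    _ ≤ (|(B.dAt s : ℝ)| ^ E * ‖B.emb p‖) * (|(B.dAt s : ℝ)| ^ E * B.lineValBound ξ s k) ^ (B.gens.h - 1) := by
        rw [hnormy]
        exact mul_le_mul_of_nonneg_left (pow_le_pow_left₀ (house_nonneg _) hhouse _) (by positivity)
    _ = _ := by ring


/-- **Liouville, contrapositive form.** [cite: Baker1975, Ch. 2 Lemma 5] -/
theorem lineVal_eq_zero_of_norm_lt {D' : ℕ} (ξ : UIdx β γ δ D' → 𝓞 B.K) (s k : ℕ) {cg : Fin B.dd → ℕ}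
    (hcg : ∀ m, cg m ≤ k)
    (hlt : ‖B.emb (MvPolynomial.eval (fun m => (cg m : B.K)) (B.lineValPoly ξ s k))‖ *
      |(B.dAt s : ℝ)| ^ B.expE (Fintype.card (β ⊕ (γ ⊕ δ)) * D') k *
        (|(B.dAt s : ℝ)| ^ B.expE (Fintype.card (β ⊕ (γ ⊕ δ)) * D') k * B.lineValBound ξ s k) ^ (B.gens.h - 1) < 1) :
    MvPolynomial.eval (fun m => (cg m : B.K)) (B.lineValPoly ξ s k) = 0 := by
  by_contra hne
  exact absurd (B.one_le_of_lineVal_ne_zero ξ s k hcg hne) (not_le.mpr hlt)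


end BakerData

end LineVals

/-! ### Sharp and spaced variants of the auxiliary construction -/

section Sharp

open Finset NumberField

namespace BakerData

variable (B : BakerData 𝓙 β γ δ)

/-- The equations: `(s, α)` with `s ≤ S₀` and a content `α : Fin dd → Fin T`. [folklore] -/
abbrev EIdx₂ (T S₀ : ℕ) : Type := Fin (S₀ + 1) × (Fin B.dd → Fin T)


/-- The order of the row `(s, α)`: `|α| = ∑_m α_m`. [folklore] -/
def rowOrder {T : ℕ} (α : Fin B.dd → Fin T) : ℕ := ∑ m, (α m : ℕ)


/-- **The sharp Siegel matrix**: the row `(s, α)` is `d_s^{E(D,|α|)} · ∑_{content α} entryVal`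
when `|α| < T`, and zero otherwise. [cite: BakerWustholz2007, §6.8 (p. 118)] -/
def sMat₂ (D' T S₀ : ℕ) : Matrix (B.EIdx₂ T S₀) (UIdx β γ δ D') (𝓞 B.K) := fun r u =>
  if B.rowOrder r.2 < T then
    ⟨(B.dAt r.1 : B.K) ^ B.expE (Fintype.card (β ⊕ (γ ⊕ δ)) * D') (B.rowOrder r.2) *
        B.rowSum (Fintype.card (β ⊕ (γ ⊕ δ)) * D') r.1 (B.rowOrder r.2) r.2 (νOf u),
      B.isIntegral_rowSum _ _ _ _ (degree_νOf_le u)⟩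
  else 0


/-- Cardinality of the equations: `(S₀+1)·T^{dd}`. [folklore] -/
theorem card_EIdx₂ (T S₀ : ℕ) : Fintype.card (B.EIdx₂ T S₀) = (S₀ + 1) * T ^ B.dd := by
  simp [EIdx₂]


/-- The entries of the sharp matrix have house `≤ houseBound` (they are entries of the matrix of
`SiegelSystem.lean`, or zero). [folklore] -/
theorem house_sMat₂_le (D' T S₀ : ℕ) (r : B.EIdx₂ T S₀) (u : UIdx β γ δ D') :
    house ((B.sMat₂ D' T S₀ r u : 𝓞 B.K) : B.K) ≤ B.houseBound D' T S₀ := by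
  unfold sMat₂
  split_ifs with h
  · have := B.house_sMat_le D' T S₀ (r.1, ⟨B.rowOrder r.2, h⟩, r.2) u
    simpa [sMat] using this
  · have h0 : house ((0 : 𝓞 B.K) : B.K) = 0 := by simp [house]
    rw [h0]
    exact zero_le_one.trans (B.one_le_houseBound D' T S₀)


variable [DecidableEq β] [DecidableEq δ]

/-- A solution of the sharp system kills the row sums of the rows of order `< T`. [folklore] -/
theorem rowSum_eq_zero_of_mulVec₂ {D' T S₀ : ℕ} {ξ : UIdx β γ δ D' → 𝓞 B.K}
    (h : (B.sMat₂ D' T S₀).mulVec ξ = 0) (r : B.EIdx₂ T S₀) (hr : B.rowOrder r.2 < T) :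
    ∑ u, (ξ u : B.K) * B.rowSum (Fintype.card (β ⊕ (γ ⊕ δ)) * D') r.1 (B.rowOrder r.2) r.2 (νOf u) = 0 := by
  have hrow := congrFun h r
  simp only [Matrix.mulVec, dotProduct, Pi.zero_apply] at hrow
  have hrow' := congrArg (algebraMap (𝓞 B.K) B.K) hrow
  rw [map_sum, map_zero] at hrow'
  simp only [map_mul] at hrow'
  have e : ∑ u, algebraMap (𝓞 B.K) B.K (B.sMat₂ D' T S₀ r u) * algebraMap (𝓞 B.K) B.K (ξ u) =
      (B.dAt r.1 : B.K) ^ B.expE (Fintype.card (β ⊕ (γ ⊕ δ)) * D') (B.rowOrder r.2) *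
        ∑ u, (ξ u : B.K) * B.rowSum (Fintype.card (β ⊕ (γ ⊕ δ)) * D') r.1 (B.rowOrder r.2) r.2 (νOf u) := by
    rw [Finset.mul_sum]
    refine Finset.sum_congr rfl fun u _ => ?_
    rw [show algebraMap (𝓞 B.K) B.K (B.sMat₂ D' T S₀ r u) = ((B.sMat₂ D' T S₀ r u : 𝓞 B.K) : B.K) from rfl,
      show algebraMap (𝓞 B.K) B.K (ξ u) = ((ξ u : 𝓞 B.K) : B.K) from rfl]
    simp only [sMat₂, if_pos hr]
    show ((B.dAt r.1 : B.K) ^ _ * B.rowSum _ _ _ _ _) * _ = _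
    ring
  rw [e] at hrow'
  exact (mul_eq_zero.mp hrow').resolve_left (pow_ne_zero _ (B.dAt_ne_zero _))


/-- **The sharp system encodes the vanishing conditions.** [cite: BakerWustholz2007, §6.8 (p. 118)] -/
theorem vanishesAlong_of_mulVec₂ {D' T S₀ : ℕ} {ξ : UIdx β γ δ D' → 𝓞 B.K}
    (h : (B.sMat₂ D' T S₀).mulVec ξ = 0) {s : ℕ} (hs : s ≤ S₀) :
    VanishesAlong (Submodule.span ℂ (Set.range B.xs))
      (thetaEval B.L B.cls B.κM (homog (Fintype.card (β ⊕ (γ ⊕ δ)) * D') (B.QOf ξ))) ((s : ℂ) • B.v) T := by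
  set D := Fintype.card (β ⊕ (γ ⊕ δ)) * D' with hD
  refine vanishesAlong_span_of_wordForms B.L B.cls B.κM (isHomogeneous_homog D _) (B.cAt s)
    (fun x => zero_mem_chartDomain_chartChoiceAt B.L B.cls _ x) B.xs T fun k hk α => ?_
  -- word forms of `P`
  have hP : ∀ ω : Fin k → Fin B.dd, wordForm B.L B.cls B.κM (B.cAt s) B.xs ((s : ℂ) • B.v) ω (homog D (B.QOf ξ)) =
      B.emb (∑ u, (ξ u : B.K) * B.entryVal s ω D (νOf u)) := fun ω => B.wordForm_homog_QOf ξ s ω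
  by_cases hsum : ∑ m, (α m : ℕ) = k
  · -- the row `(s, α)` of order `k`
    let α' : Fin B.dd → Fin T := fun m => ⟨α m, lt_of_lt_of_le (α m).isLt (Nat.succ_le_of_lt hk)⟩
    have hord : B.rowOrder α' = k := by simp [rowOrder, α', hsum]
    have hrow := B.rowSum_eq_zero_of_mulVec₂ h (⟨s, Nat.lt_succ_of_le hs⟩, α') (by rw [hord]; exact hk)
    simp only [hord] at hrow
    have hset : Finset.univ.filter (fun ω : Fin k → Fin B.dd => ∀ m, PolyODE.content ω m = α m) =
        B.wordsOf k α' := by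
      ext ω; simp [wordsOf, α']
    rw [Finset.sum_congr rfl fun ω _ => hP ω, ← map_sum, hset]
    rw [show ∑ ω ∈ B.wordsOf k α', ∑ u, (ξ u : B.K) * B.entryVal s ω D (νOf u) =
        ∑ u, (ξ u : B.K) * B.rowSum D s k α' (νOf u) from by
      rw [Finset.sum_comm]
      refine Finset.sum_congr rfl fun u _ => ?_
      rw [rowSum, Finset.mul_sum]]
    rw [hrow, map_zero]
  · -- no word of length `k` has content `α`
    refine Finset.sum_eq_zero fun ω hω => ?_
    exfalso
    apply hsum
    have hc := (Finset.mem_filter.mp hω).2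
    calc ∑ m, (α m : ℕ) = ∑ m, PolyODE.content ω m := Finset.sum_congr rfl fun m _ => (hc m).symm
      _ = k := PolyODE.sum_content ω


/-- **The auxiliary function with the sharp count.** For `T ≥ 1` and `(S₀+1)·T^{dd} < (D'+1)^n`
there is `ξ ≠ 0` in `𝓞 K^{unknowns}` within the Siegel house bound such that `P = homog (nD') (QOf ξ)`
has `F_P ≢ 0` and vanishes to order `≥ T` along `𝔟` at `s·v`, `s ≤ S₀`.
[cite: BakerWustholz2007, §6.8 (pp. 118–119)] -/
theorem exists_auxiliary₂ (D' T S₀ : ℕ) (hT : 0 < T)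
    (hpq : (S₀ + 1) * T ^ B.dd < (D' + 1) ^ Fintype.card (β ⊕ (γ ⊕ δ))) :
    ∃ ξ : UIdx β γ δ D' → 𝓞 B.K, ξ ≠ 0 ∧
      (∀ u, house ((ξ u : 𝓞 B.K) : B.K) ≤ siegelConst B.K *
        (siegelConst B.K * ((D' + 1) ^ Fintype.card (β ⊕ (γ ⊕ δ)) : ℕ) * B.houseBound D' T S₀) ^
          ((((S₀ + 1) * T ^ B.dd : ℕ) : ℝ) /
            ((((D' + 1) ^ Fintype.card (β ⊕ (γ ⊕ δ)) : ℕ) : ℝ) - ((S₀ + 1) * T ^ B.dd : ℕ)))) ∧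
      (∃ w, thetaEval B.L B.cls B.κM (homog (Fintype.card (β ⊕ (γ ⊕ δ)) * D') (B.QOf ξ)) w ≠ 0) ∧
      ∀ s ≤ S₀, VanishesAlong (Submodule.span ℂ (Set.range B.xs))
        (thetaEval B.L B.cls B.κM (homog (Fintype.card (β ⊕ (γ ⊕ δ)) * D') (B.QOf ξ))) ((s : ℂ) • B.v) T := by
  have h0p : 0 < (S₀ + 1) * T ^ B.dd := Nat.mul_pos (Nat.succ_pos _) (pow_pos hT _)
  obtain ⟨ξ, hξ, hmul, hhouse⟩ := siegel_house B.K (B.sMat₂ D' T S₀) h0p hpq (B.card_EIdx₂ T S₀) (card_UIdx D')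
    (B.one_le_houseBound D' T S₀) (fun r u => B.house_sMat₂_le D' T S₀ r u)
  refine ⟨ξ, hξ, fun u => hhouse u, ?_, fun s hs => B.vanishesAlong_of_mulVec₂ hmul hs⟩
  exact exists_thetaEval_homog_ne_zero B.L B.cls B.κM (B.QOf_ne_zero hξ) (B.totalDegree_QOf_le ξ)


end BakerData

end Sharp

end Std

end GaGmEFam

end Literature.NumberTheory.Transcendental

end
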